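import Literature.AlgebraicGeometry.Motives.HodgeThetaAnnihilatorTimesRigidBlocks
import HarnessLib

/-!
# Rational tensors on `V₁ ⊕ V₂` killed by `Θ` are killed by `0 ⊕ hg(V₂)` and by `Θ₁ ⊕ 0` when `hg(V₂)_ℂ = ⊕ᵢ 𝔰𝔭(Wᵢ)` acts through ISOTYPIC rigid blocks `V₂ ⊗ ℂ = ⊕ᵢ (T_(i,0) ⊕ T_(i,1))`, `T_(i,1) = uᵢ T_(i,0)`, and there is no non-zero morphism of Hodge structures `V₂ → V₁` (Moonen–Zarhin 1999 Lemma (3.4) with (3.3), the Lie step of Hazama's theorem, for a second factor of TYPE II: `hg ⊗ ℂ = ⊕_places 𝔰𝔭(W_v)` acting diagonally on `W_v ⊗ ℂ²`)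

HONEST FRAMING (programme `pub-hodge-ring2`, verbatim): «research route conditional on HC_CM; not a corollary;
Q11.4-sentence-2 already refuted in dim ≥ 3». For THIS file: it is a step (R56) of the research route towards products
with a stably nondegenerate factor whose endomorphism algebra is a totally indefinite quaternion algebra (Albert type II);
its content is UNCONDITIONAL linear algebra (theorems only, no new definitions, no named facts).

## The statement and its place

The tree's `Motives/HodgeThetaAnnihilatorTimesRigidBlocks` proves the Goursat–Lie step of Hazama's theorem
[Hazama1989] / Moonen–Zarhin [MoonenZarhin1999LowDim, Thm. (3.2)(1), Lemma (3.4)] for a second factor `V₂` whose complexified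
Hodge Lie algebra is the FULL block-symplectic algebra `⊕_k 𝔰𝔭(T_k)` of an internal direct sum `V₂ ⊗ ℂ = ⊕_k T_k` of
mutually orthogonal blocks (RIGID BLOCKS: every block-preserving skew operator is in `hg ⊗ ℂ`) — the shape of `hg ⊗ ℂ` for
real multiplication by a totally real field under (D). For an abelian variety of type II (endomorphism algebra a totally
indefinite quaternion algebra `D` over a totally real field `K`) under (D) the shape is different: over `ℝ`,
`D ⊗ ℝ ≅ ∏_v M₂(ℝ)` splits `V₂ ⊗ ℂ = ⊕_v (T_(v,0) ⊕ T_(v,1))` by the matrix units `e(v)_{ab}`, the two blocks of a place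
being GLUED by the units `u_v = e(v)₁₀ : T_(v,0) ⥲ T_(v,1)`, `v_v = e(v)₀₁ : T_(v,1) ⥲ T_(v,0)`, and
`hg ⊗ ℂ = ⊕_v 𝔰𝔭(T_(v,0))` acts DIAGONALLY: `Y = ∑_v (Y_v + u_v Y_v v_v)` (Milne's Prop. 4.8 (a)⇒(c); in the tree
`HodgeTheory/StablyNondegenerateHodgeLieTypeII`). This file proves the Goursat–Lie step for such ISOTYPIC rigid blocks,
abstractly: the data are an internal orthogonal direct sum `V₂ ⊗ ℂ = ⊕_{(i,a) ∈ ι × Fin 2} T_(i,a)` stable under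
`hg(V₂) ⊗ ℂ`, gluing maps `u_i`, `v_i` (mutually inverse between `T_(i,0)` and `T_(i,1)`, zero on the other blocks,
commuting with `hg ⊗ ℂ`), and (ISOTYPIC RIGIDITY) for every `ψ₂ ⊗ ℂ`-skew `N` supported on `T_(i,0)` the doubled operator
`N + u_i N v_i` lies in `hg(V₂) ⊗ ℂ`. Conclusion (`goursat_incl₂_mem_of_hom_eq_zero_of_isotypicBlocks`): if no non-zero
`ℚ`-linear `V₂ → V₁` intertwines the Hodge operators, then `ι₂ Z π₂ ∈ 𝔞` for every `Z ∈ Lie Hg(H₂)` and every bracket-closed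
block-diagonal `𝔞 ∋ Θ_U` with skew first corners; the word-model consumers (`…_of_times_isotypicBlocks`) are those of the
rigid-blocks file verbatim.

PROOF. Hazama's Goursat argument exactly as in the rigid-blocks file (whose §0 lemmas — the `Θ`-weight vanishing lemma
`SymplecticWitness.eq_zero_of_theta_bracket_of_bracket` and `SymplecticWitness.P_ne_bot_of_nontrivial` — and whose whole
`𝔞₃'`/`ρ = c₁ ∘ c₂⁻¹` set-up are reused), with the extension operators `ext_k` of the blocks replaced by the DOUBLED extensions
`E_i g = ext_(i,0) g + u_i ext_(i,0) g v_i` of the representative blocks `T_(i,0)`: `E_i` is multiplicative, `E_i E_j = 0`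
for `i ≠ j`, `E_i [Θ|, g] = [Θ₂, E_i g]` (as `Θ₂ ∈ hg ⊗ ℂ` commutes with `u_i`, `v_i`), every `Y ∈ hg ⊗ ℂ` is
`∑_i E_i (Y|_{T_(i,0)})` (as `Y|_{T_(i,1)} = u_i Y|_{T_(i,0)} v_i`), so `ρ ∘ E_i` is a bracket- and `ad Θ`-compatible linear
map on `𝔰𝔭(T_(i,0))` and the dichotomy (kernel a non-zero ideal ⟹ contains `Θ|` ⟹ `ρ E_i = 0`; kernel zero ⟹ a non-zero
equivariant `F : T_(i,0) → V₁ ⊗ ℂ`, killed by the other places by the weight lemma, whence a rational `Z` commuting with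
`𝔞₃'` whose corner `f = π₁ Z ι₂` is `ρ`-equivariant) runs verbatim; the only new point is the last step, where `f`
intertwines `Θ₂` and `Θ₁` on `T_(j,0)` by `SymplecticWitness.theta_comp_eq_of_equivariant` applied to `f|_{T_(j,0)}` AND on
`T_(j,1) = u_j T_(j,0)` by the same lemma applied to the equivariant map `f ∘ u_j|_{T_(j,0)}` (`E_j g ∘ u_j = u_j ∘ g` on
`T_(j,0)`, and `Θ₂ u_j = u_j Θ₂`).

No hypothesis is made on `V₁`, none on the number or the ranks of the blocks (an empty place contributes the zero
algebra), and `V₂ = 0` is allowed.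

## References

* [MoonenZarhin1999LowDim] B. Moonen, Yu. G. Zarhin, Math. Ann. 315 (1999) 711–733, §3 (3.1), Lemma (3.3), Lemma (3.4),
  Thm. (3.2)(1) (held: `paper:arxiv-math_9901113` pp. 6–7). [cite: MoonenZarhin1999LowDim, §3 Lemma (3.3) and Lemma (3.4)]
* [Hazama1989] F. Hazama, Duke Math. J. 58 (1989) 31–37 (Goursat for Hodge Lie algebras; = Gordon's survey Thm. 7.6.2).
  [cite: Hazama1989, Thm. (= Gordon 7.6.2)]
* [Milne1999LefschetzClasses] J. S. Milne, Lefschetz classes on abelian varieties, Duke Math. J. 96 (1999), Prop. 4.8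
  (p. 660) and its table (type II: `S = Sp` acting diagonally on `W ⊗ ℂ²`). [cite: Milne1999LefschetzClasses, Prop. 4.8 (p. 660)]
* [Deligne1982HodgeCycles] P. Deligne, LNM 900 (1982), I §3 Prop. 3.4 (minimality, descent), Prop. 3.6 (reductivity).
  [cite: Deligne1982HodgeCycles, I §3 Prop. 3.4 and Prop. 3.6]
-/

noncomputable section

open scoped TensorProduct
open CategoryTheory Module

namespace Literature.AlgebraicGeometry.Motives

namespace HodgeStructure

open Literature.RepresentationTheory.GeneralLinear

/-! ### §1 Block calculus for an internal direct sum `W = ⊕ᵢ Tᵢ`: the projections `pᵢ : W → Tᵢ` -/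

section Blocks

variable {W : Type*} [AddCommGroup W] [Module ℂ W] {ι : Type*} [Fintype ι] [DecidableEq ι]

/-- **Projections of an internal direct sum.** For `W = ⊕ᵢ Tᵢ` internal there are linear `pᵢ : W → Tᵢ` with `pᵢ|_{Tᵢ} = id`,
`pᵢ|_{Tⱼ} = 0` (`j ≠ i`), `∑ᵢ pᵢ = id`, and `pᵢ ∘ Y = Y|_{Tᵢ} ∘ pᵢ` for every block-preserving `Y` (the projection onto `Tᵢ`
along `⊕_{j ≠ i} Tⱼ`, Mathlib's `Submodule.projectionOnto`; a copy of the private lemma of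
`HodgeThetaAnnihilatorTimesRigidBlocks`). [folklore] -/
private theorem Blocks.exists_proj_iso (T : ι → Submodule ℂ W) (hint : DirectSum.IsInternal T) :
    ∃ p : ∀ i, W →ₗ[ℂ] ↥(T i), (∀ i (x : T i), p i x = x) ∧ (∀ i j, j ≠ i → ∀ x ∈ T j, p i x = 0) ∧
      (∀ x, ∑ i, ((p i x : T i) : W) = x) ∧
      (∀ Y : Module.End ℂ W, (∀ i, Set.MapsTo Y (T i) (T i)) → ∀ i x, ((p i (Y x) : T i) : W) = Y (p i x)) := by
  classical
  have hind : iSupIndep T := hint.submodule_iSupIndep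
  have htop : ⨆ i, T i = ⊤ := hint.submodule_iSup_eq_top
  have hC : ∀ i, IsCompl (T i) (⨆ (j) (_ : j ≠ i), T j) := fun i =>
    ⟨(iSupIndep_def.1 hind) i, by
      rw [codisjoint_iff, ← iSup_split_single T i]
      exact htop⟩
  set p : ∀ i, W →ₗ[ℂ] ↥(T i) := fun i => Submodule.projectionOnto (T i) (⨆ (j) (_ : j ≠ i), T j) (hC i) with hp
  have hp1 : ∀ i (x : T i), p i x = x := fun i x => Submodule.projectionOnto_apply_left (hC i) x
  have hp2 : ∀ i j, j ≠ i → ∀ x ∈ T j, p i x = 0 := by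
    intro i j hji x hx
    have hxC : x ∈ ⨆ (j) (_ : j ≠ i), T j :=
      Submodule.mem_iSup_of_mem j (Submodule.mem_iSup_of_mem hji hx)
    exact Submodule.projectionOnto_apply_right (hC i) ⟨x, hxC⟩
  have hp3 : ∀ x, ∑ i, ((p i x : T i) : W) = x := by
    intro x
    have hx : x ∈ ⨆ i, T i := by rw [htop]; exact Submodule.mem_top
    induction hx using Submodule.iSup_induction' with
    | mem k x hx =>
      rw [Finset.sum_eq_single k]
      · rw [Submodule.projectionOnto_apply_of_mem_left (hC k) hx]
      · intro i _ hik
        rw [hp2 i k (Ne.symm hik) x hx, Submodule.coe_zero]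
      · intro hk; exact absurd (Finset.mem_univ k) hk
    | zero => simp
    | add x y _ _ hx hy =>
      conv_rhs => rw [← hx, ← hy]
      rw [← Finset.sum_add_distrib]
      exact Finset.sum_congr rfl fun i _ => by rw [map_add, Submodule.coe_add]
  refine ⟨p, hp1, hp2, hp3, fun Y hY i x => ?_⟩
  conv_lhs => rw [← hp3 x, map_sum, map_sum]
  rw [Submodule.coe_sum, Finset.sum_eq_single i]
  · rw [Submodule.projectionOnto_apply_of_mem_left (hC i) (hY i (p i x).2)]
  · intro k _ hki
    rw [hp2 i k hki _ (hY k (p k x).2), Submodule.coe_zero]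
  · intro hi; exact absurd (Finset.mem_univ i) hi

/-- `Fin 2 = {0, 1}`. [folklore] -/
private theorem fin2_eq_zero_or_one_ib (r : Fin 2) : r = 0 ∨ r = 1 := by
  fin_cases r <;> simp

end Blocks

/-! ### §2 The Goursat step for a second factor with ISOTYPIC rigid symplectic blocks: `Hom = 0` kills the graph -/

section Goursat

universe u

variable {U V₁ V₂ : Type u} [AddCommGroup U] [Module ℚ U] [AddCommGroup V₁] [Module ℚ V₁]
  [AddCommGroup V₂] [Module ℚ V₂] [Module.Finite ℚ U] [Module.Finite ℚ V₁] [Module.Finite ℚ V₂]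
  [HodgeTensorFacts.{u, u}] {n : ℤ} {ιp : Type} [Fintype ιp] [DecidableEq ιp]

set_option maxHeartbeats 800000 in
/-- **The Goursat step for a second factor with isotypic rigid symplectic blocks (Moonen–Zarhin Lemma (3.4), Lie form,
for `hg(X₂) ⊗ ℂ = ⊕ᵢ 𝔰𝔭(T_(i,0))` acting diagonally on `T_(i,0) ⊕ T_(i,1) = T_(i,0) ⊗ ℂ²`: the type II shape).**
Let `U = ι₁V₁ ⊕ ι₂V₂` and let `𝔞 ⊆ End_ℚ(U)` be a bracket-closed space of block-diagonal operators with `ψ₁`-skew first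
corners, whose complex span contains an operator `Θ_U` inducing the Hodge operators `Θ₁`, `Θ₂` of the effective
weight-one structures `H₁`, `H₂` on the blocks. On `V₂`: `V₂ ⊗ ℂ = ⊕_{(i,a)} T_(i,a)` (`a ∈ Fin 2`) is an internal direct
sum of mutually `ψ₂ ⊗ ℂ`-orthogonal blocks stable under `Lie Hg(H₂) ⊗ ℂ`; `u_i`, `v_i` are operators with
`u_i T_(i,0) ⊆ T_(i,1)`, `v_i T_(i,1) ⊆ T_(i,0)`, `v_i u_i = 1` on `T_(i,0)`, `u_i v_i = 1` on `T_(i,1)`, zero on the other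
blocks, commuting with `Lie Hg(H₂) ⊗ ℂ`; and (ISOTYPIC RIGIDITY) for every `ψ₂ ⊗ ℂ`-skew `N` with image in `T_(i,0)`
killing the other blocks, `N + u_i N v_i ∈ Lie Hg(H₂) ⊗ ℂ` (so `Lie Hg(H₂) ⊗ ℂ = ⊕ᵢ 𝔰𝔭(T_(i,0))` embedded diagonally: the
tree's theorem for a simple abelian variety of type II under (D), `HodgeTheory/StablyNondegenerateHodgeLieTypeII`). If NO
non-zero `ℚ`-linear `f : V₂ → V₁` intertwines `Θ₂` and `Θ₁` («`Hom(X₂, X₁) = 0`»), then `ι₂ Z π₂ ∈ 𝔞` for every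
`Z ∈ Lie Hg(H₂)` («`Hg(X₁ × X₂) ⊇ 1 × Hg(X₂)`»). PROOF (Hazama's Goursat argument, Moonen–Zarhin (3.1)–(3.4)), as in
`goursat_incl₂_mem_of_hom_eq_zero_of_rigidBlocks` with the doubled extensions `E_i g = ext_(i,0) g + u_i ext_(i,0) g v_i`:
`𝔤₂ = c₂(𝔞) ⊇ 𝔥 = Lie Hg(H₂)` (Deligne's minimality `hodgeLie_rigid`); the ideal `𝔨₁ = c₁(𝔞 ∩ ker c₂)` of `𝔤₁ = c₁(𝔞)`
has a complementary ideal `𝔤₃` (`exists_ideal_compl`); `𝔞₃' = 𝔞 ∩ c₁⁻¹(𝔤₃) ∩ c₂⁻¹(𝔥)` maps isomorphically onto `𝔥`,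
`ρ = c₁ ∘ c₂⁻¹ : 𝔥_ℂ → End(V₁ ⊗ ℂ)` preserves brackets and `ρ[Θ₂, Y] = [Θ₁, ρY]`. CLAIM: `ρ ∘ E_i = 0` on each
`𝔰𝔭(T_(i,0))`: its kernel is an ideal; if non-zero it contains `Θ|` (`SymplecticIdeal.theta_mem_of_ne_bot`) and
`ρ E_i = 0` (§0 of the rigid-blocks file); if zero, `SymplecticWitness.exists_equivariant_ne_zero` gives a non-zero
equivariant `F : T_(i,0) → V₁ ⊗ ℂ`, killed by `ρ E_j 𝔰𝔭(T_(j,0))`, `j ≠ i` (the `Θ`-weights), so `Z' = ι₁ F p_(i,0) π₂`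
commutes with `(𝔞₃')_ℂ`; by descent (`mem_span_baseChange_of_forall_commute`) it is a complex combination of RATIONAL `Z`
commuting with `𝔞₃'`, whose corners `f = π₁ Z ι₂` are `ρ`-equivariant, hence intertwine `Θ₂`, `Θ₁` on every `T_(j,0)`
(`theta_comp_eq_of_equivariant` for `f|`) and on every `T_(j,1) = u_j T_(j,0)` (the same for `f ∘ u_j|`), so vanish by
(HOM) — contradiction. Hence every `Y = ∑ᵢ E_i(Y|) ∈ 𝔥_ℂ` has `ρ Y = 0`, `c₁` kills `𝔞₃'`, and `Z ∈ 𝔥 = c₂(𝔞₃')` is `c₂`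
of `ι₂ Z π₂ ∈ 𝔞`. [cite: MoonenZarhin1999LowDim, §3 (3.1), Lemma (3.3), Lemma (3.4)] [cite: Hazama1989, Thm. (= Gordon 7.6.2)]
[cite: Milne1999LefschetzClasses, Prop. 4.8 (p. 660)] [cite: Deligne1982HodgeCycles, I §3 (proof of Prop. 3.4) and Prop. 3.6] -/
theorem goursat_incl₂_mem_of_hom_eq_zero_of_isotypicBlocks (hn : n = 1) (H₁ : HodgeStructure V₁ n)
    (H₂ : HodgeStructure V₂ n) (heff₁ : H₁.IsEffective) (heff₂ : H₂.IsEffective)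
    {ι₁ : V₁ →ₗ[ℚ] U} {π₁ : U →ₗ[ℚ] V₁} {ι₂ : V₂ →ₗ[ℚ] U} {π₂ : U →ₗ[ℚ] V₂}
    (hπι₁ : π₁ ∘ₗ ι₁ = LinearMap.id) (hπι₂ : π₂ ∘ₗ ι₂ = LinearMap.id) (hπ₁ι₂ : π₁ ∘ₗ ι₂ = 0)
    (hπ₂ι₁ : π₂ ∘ₗ ι₁ = 0) (hsum : ι₁ ∘ₗ π₁ + ι₂ ∘ₗ π₂ = LinearMap.id)
    (𝔞 : Submodule ℚ (Module.End ℚ U)) (hbr : ∀ X ∈ 𝔞, ∀ X' ∈ 𝔞, X * X' - X' * X ∈ 𝔞)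
    (hP₁ : ∀ X ∈ 𝔞, X * (ι₁ ∘ₗ π₁) = (ι₁ ∘ₗ π₁) * X) (hP₂ : ∀ X ∈ 𝔞, X * (ι₂ ∘ₗ π₂) = (ι₂ ∘ₗ π₂) * X)
    (ψ₁ : H₁.Polarization) (ψ₂ : H₂.Polarization)
    (hskew₁ : ∀ X ∈ 𝔞, ∀ v w, ψ₁.form ((π₁ ∘ₗ X ∘ₗ ι₁) v) w + ψ₁.form v ((π₁ ∘ₗ X ∘ₗ ι₁) w) = 0)
    {Θ₁ : Module.End ℂ (ℂ ⊗[ℚ] V₁)} (hΘ₁ : ∀ p, ∀ x ∈ H₁.piece p (n - p), Θ₁ x = ((2 * p - n : ℤ) : ℂ) • x)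
    {Θ₂ : Module.End ℂ (ℂ ⊗[ℚ] V₂)} (hΘ₂ : ∀ p, ∀ x ∈ H₂.piece p (n - p), Θ₂ x = ((2 * p - n : ℤ) : ℂ) • x)
    (Tb : ιp × Fin 2 → Submodule ℂ (ℂ ⊗[ℚ] V₂)) (hint : DirectSum.IsInternal Tb)
    (hYT : ∀ Y ∈ H₂.hodgeLieC, ∀ p, ∀ x ∈ Tb p, Y x ∈ Tb p)
    (hTorth : ∀ p p', p ≠ p' → ∀ x ∈ Tb p, ∀ y ∈ Tb p', ψ₂.form.baseChange ℂ x y = 0)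
    (uu vv : ιp → Module.End ℂ (ℂ ⊗[ℚ] V₂))
    (huT : ∀ i, ∀ x ∈ Tb (i, 0), uu i x ∈ Tb (i, 1)) (hvT : ∀ i, ∀ x ∈ Tb (i, 1), vv i x ∈ Tb (i, 0))
    (hvu : ∀ i, ∀ x ∈ Tb (i, 0), vv i (uu i x) = x) (huv : ∀ i, ∀ x ∈ Tb (i, 1), uu i (vv i x) = x)
    (hu0 : ∀ i p, p ≠ (i, 0) → ∀ x ∈ Tb p, uu i x = 0) (hv0 : ∀ i p, p ≠ (i, 1) → ∀ x ∈ Tb p, vv i x = 0)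
    (h𝔥u : ∀ Y ∈ H₂.hodgeLieC, ∀ i, Y * uu i = uu i * Y) (h𝔥v : ∀ Y ∈ H₂.hodgeLieC, ∀ i, Y * vv i = vv i * Y)
    (hrigid : ∀ (i : ιp) (N : Module.End ℂ (ℂ ⊗[ℚ] V₂)), (∀ y, N y ∈ Tb (i, 0)) →
      (∀ p, p ≠ (i, 0) → ∀ y ∈ Tb p, N y = 0) →
      (∀ x y, ψ₂.form.baseChange ℂ (N x) y + ψ₂.form.baseChange ℂ x (N y) = 0) → N + uu i * N * vv i ∈ H₂.hodgeLieC)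
    {ΘU : Module.End ℂ (ℂ ⊗[ℚ] U)} (hΘU𝔞 : ΘU ∈ spanC 𝔞)
    (hΘUι₁ : ∀ x, ΘU (ι₁.baseChange ℂ x) = ι₁.baseChange ℂ (Θ₁ x))
    (hΘUι₂ : ∀ x, ΘU (ι₂.baseChange ℂ x) = ι₂.baseChange ℂ (Θ₂ x))
    (hHom : ∀ f : V₂ →ₗ[ℚ] V₁, Θ₁ ∘ₗ f.baseChange ℂ = f.baseChange ℂ ∘ₗ Θ₂ → f = 0) :
    ∀ Z₂ ∈ H₂.hodgeLie, ι₂ ∘ₗ Z₂ ∘ₗ π₂ ∈ 𝔞 := by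
  classical
  have hsum' : ι₂ ∘ₗ π₂ + ι₁ ∘ₗ π₁ = LinearMap.id := by rw [add_comm]; exact hsum
  -- the corner maps as linear maps, rational and complex
  obtain ⟨cL₁, hcL₁⟩ : ∃ L : Module.End ℚ U →ₗ[ℚ] Module.End ℚ V₁, ∀ X, L X = π₁ ∘ₗ X ∘ₗ ι₁ :=
    ⟨{ toFun := fun X => π₁ ∘ₗ X ∘ₗ ι₁
       map_add' := fun X X' => by rw [LinearMap.add_comp, LinearMap.comp_add]
       map_smul' := fun c X => by rw [LinearMap.smul_comp, LinearMap.comp_smul, RingHom.id_apply] },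
      fun X => rfl⟩
  obtain ⟨cL₂, hcL₂⟩ : ∃ L : Module.End ℚ U →ₗ[ℚ] Module.End ℚ V₂, ∀ X, L X = π₂ ∘ₗ X ∘ₗ ι₂ :=
    ⟨{ toFun := fun X => π₂ ∘ₗ X ∘ₗ ι₂
       map_add' := fun X X' => by rw [LinearMap.add_comp, LinearMap.comp_add]
       map_smul' := fun c X => by rw [LinearMap.smul_comp, LinearMap.comp_smul, RingHom.id_apply] },
      fun X => rfl⟩
  obtain ⟨LC₁, hLC₁⟩ : ∃ L : Module.End ℂ (ℂ ⊗[ℚ] U) →ₗ[ℂ] Module.End ℂ (ℂ ⊗[ℚ] V₁),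
      ∀ T, L T = π₁.baseChange ℂ ∘ₗ T ∘ₗ ι₁.baseChange ℂ :=
    ⟨{ toFun := fun T => π₁.baseChange ℂ ∘ₗ T ∘ₗ ι₁.baseChange ℂ
       map_add' := fun T T' => by rw [LinearMap.add_comp, LinearMap.comp_add]
       map_smul' := fun c T => by rw [LinearMap.smul_comp, LinearMap.comp_smul, RingHom.id_apply] },
      fun T => rfl⟩
  obtain ⟨LC₂, hLC₂⟩ : ∃ L : Module.End ℂ (ℂ ⊗[ℚ] U) →ₗ[ℂ] Module.End ℂ (ℂ ⊗[ℚ] V₂),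
      ∀ T, L T = π₂.baseChange ℂ ∘ₗ T ∘ₗ ι₂.baseChange ℂ :=
    ⟨{ toFun := fun T => π₂.baseChange ℂ ∘ₗ T ∘ₗ ι₂.baseChange ℂ
       map_add' := fun T T' => by rw [LinearMap.add_comp, LinearMap.comp_add]
       map_smul' := fun c T => by rw [LinearMap.smul_comp, LinearMap.comp_smul, RingHom.id_apply] },
      fun T => rfl⟩
  have hLC₁c : ∀ X : Module.End ℚ U, LC₁ (X.baseChange ℂ) = (cL₁ X).baseChange ℂ := fun X => by
    rw [hLC₁, hcL₁, LinearMap.baseChange_comp, LinearMap.baseChange_comp]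
  have hLC₂c : ∀ X : Module.End ℚ U, LC₂ (X.baseChange ℂ) = (cL₂ X).baseChange ℂ := fun X => by
    rw [hLC₂, hcL₂, LinearMap.baseChange_comp, LinearMap.baseChange_comp]
  -- corners of brackets
  have hc₁br : ∀ X ∈ 𝔞, ∀ X' ∈ 𝔞, π₁ ∘ₗ (X * X' - X' * X) ∘ₗ ι₁ =
      (π₁ ∘ₗ X ∘ₗ ι₁) * (π₁ ∘ₗ X' ∘ₗ ι₁) - (π₁ ∘ₗ X' ∘ₗ ι₁) * (π₁ ∘ₗ X ∘ₗ ι₁) := fun X hX X' hX' =>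
    corner_bracket hπι₁ hπι₂ hπ₁ι₂ hsum (hP₁ X hX) (hP₂ X hX) (hP₁ X' hX') (hP₂ X' hX')
  have hc₂br : ∀ X ∈ 𝔞, ∀ X' ∈ 𝔞, π₂ ∘ₗ (X * X' - X' * X) ∘ₗ ι₂ =
      (π₂ ∘ₗ X ∘ₗ ι₂) * (π₂ ∘ₗ X' ∘ₗ ι₂) - (π₂ ∘ₗ X' ∘ₗ ι₂) * (π₂ ∘ₗ X ∘ₗ ι₂) := fun X hX X' hX' =>
    corner_bracket hπι₂ hπι₁ hπ₂ι₁ hsum' (hP₂ X hX) (hP₁ X hX) (hP₂ X' hX') (hP₁ X' hX')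
  -- the corner algebras `𝔤₁ = c₁(𝔞)`, `𝔤₂ = c₂(𝔞)`
  set 𝔤₁ : Submodule ℚ (Module.End ℚ V₁) := 𝔞.map cL₁ with h𝔤₁
  have h𝔤₁mem : ∀ {Y}, Y ∈ 𝔤₁ ↔ ∃ X ∈ 𝔞, π₁ ∘ₗ X ∘ₗ ι₁ = Y := by
    intro Y
    rw [h𝔤₁, Submodule.mem_map]
    simp only [hcL₁]
  have hbr𝔤₁ : ∀ Y ∈ 𝔤₁, ∀ Y' ∈ 𝔤₁, Y * Y' - Y' * Y ∈ 𝔤₁ := by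
    intro Y hY Y' hY'
    obtain ⟨X, hX, rfl⟩ := h𝔤₁mem.1 hY
    obtain ⟨X', hX', rfl⟩ := h𝔤₁mem.1 hY'
    exact h𝔤₁mem.2 ⟨_, hbr X hX X' hX', hc₁br X hX X' hX'⟩
  have hskew𝔤₁ : ∀ Y ∈ 𝔤₁, ∀ v w, ψ₁.form (Y v) w + ψ₁.form v (Y w) = 0 := by
    intro Y hY v w
    obtain ⟨X, hX, rfl⟩ := h𝔤₁mem.1 hY
    exact hskew₁ X hX v w
  set 𝔤₂ : Submodule ℚ (Module.End ℚ V₂) := 𝔞.map cL₂ with h𝔤₂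
  have h𝔤₂mem : ∀ {Y}, Y ∈ 𝔤₂ ↔ ∃ X ∈ 𝔞, π₂ ∘ₗ X ∘ₗ ι₂ = Y := by
    intro Y
    rw [h𝔤₂, Submodule.mem_map]
    simp only [hcL₂]
  have hbr𝔤₂ : ∀ Y ∈ 𝔤₂, ∀ Y' ∈ 𝔤₂, Y * Y' - Y' * Y ∈ 𝔤₂ := by
    intro Y hY Y' hY'
    obtain ⟨X, hX, rfl⟩ := h𝔤₂mem.1 hY
    obtain ⟨X', hX', rfl⟩ := h𝔤₂mem.1 hY'
    exact h𝔤₂mem.2 ⟨_, hbr X hX X' hX', hc₂br X hX X' hX'⟩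
  -- `Θ_i = c_i(Θ_U) ∈ (𝔤_i)_ℂ`
  have hΘ₁eq : LC₁ ΘU = Θ₁ := by
    rw [hLC₁]
    apply LinearMap.ext
    intro x
    rw [LinearMap.comp_apply, LinearMap.comp_apply, hΘUι₁, proj_incl_baseChange hπι₁]
  have hΘ₂eq : LC₂ ΘU = Θ₂ := by
    rw [hLC₂]
    apply LinearMap.ext
    intro x
    rw [LinearMap.comp_apply, LinearMap.comp_apply, hΘUι₂, proj_incl_baseChange hπι₂]
  have hΘ𝔤₁ : Θ₁ ∈ spanC 𝔤₁ := by rw [← hΘ₁eq]; exact map_mem_spanC_map cL₁ LC₁ hLC₁c 𝔞 hΘU𝔞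
  have hΘ𝔤₂ : Θ₂ ∈ spanC 𝔤₂ := by rw [← hΘ₂eq]; exact map_mem_spanC_map cL₂ LC₂ hLC₂c 𝔞 hΘU𝔞
  -- `Θ² = 1` on the blocks
  have hΘΘ₁ : ∀ v, Θ₁ (Θ₁ v) = v := theta_theta_apply H₁ hn heff₁ hΘ₁
  have hΘΘ₂ : ∀ v, Θ₂ (Θ₂ v) = v := theta_theta_apply H₂ hn heff₂ hΘ₂
  -- block calculus for elements of `𝔞_ℂ`
  have hPC₁ : ∀ T ∈ spanC 𝔞, T * (ι₁.baseChange ℂ ∘ₗ π₁.baseChange ℂ) = (ι₁.baseChange ℂ ∘ₗ π₁.baseChange ℂ) * T := by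
    intro T hT
    have h := mul_baseChange_eq_of_mem_spanC hP₁ hT
    rwa [LinearMap.baseChange_comp] at h
  have hPC₂ : ∀ T ∈ spanC 𝔞, T * (ι₂.baseChange ℂ ∘ₗ π₂.baseChange ℂ) = (ι₂.baseChange ℂ ∘ₗ π₂.baseChange ℂ) * T := by
    intro T hT
    have h := mul_baseChange_eq_of_mem_spanC hP₂ hT
    rwa [LinearMap.baseChange_comp] at h
  have happlyι₁ : ∀ T ∈ spanC 𝔞, ∀ v, T (ι₁.baseChange ℂ v) = ι₁.baseChange ℂ (LC₁ T v) := by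
    intro T hT v
    have h := congrArg (fun S : Module.End ℂ (ℂ ⊗[ℚ] U) => S (ι₁.baseChange ℂ v)) (hPC₁ T hT)
    simp only [Module.End.mul_apply, LinearMap.comp_apply, proj_incl_baseChange hπι₁] at h
    rw [hLC₁, LinearMap.comp_apply, LinearMap.comp_apply]
    exact h
  have happlyι₂ : ∀ T ∈ spanC 𝔞, ∀ v, T (ι₂.baseChange ℂ v) = ι₂.baseChange ℂ (LC₂ T v) := by
    intro T hT v
    have h := congrArg (fun S : Module.End ℂ (ℂ ⊗[ℚ] U) => S (ι₂.baseChange ℂ v)) (hPC₂ T hT)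
    simp only [Module.End.mul_apply, LinearMap.comp_apply, proj_incl_baseChange hπι₂] at h
    rw [hLC₂, LinearMap.comp_apply, LinearMap.comp_apply]
    exact h
  have hprojT₁ : ∀ T ∈ spanC 𝔞, ∀ y, π₁.baseChange ℂ (T y) = LC₁ T (π₁.baseChange ℂ y) := by
    intro T hT y
    conv_lhs => rw [← incl_proj_add_baseChange hsum y]
    rw [map_add, happlyι₁ T hT, happlyι₂ T hT, map_add, proj_incl_baseChange hπι₁,
      proj_incl_baseChange_eq_zero hπ₁ι₂, add_zero]
  have hprojT₂ : ∀ T ∈ spanC 𝔞, ∀ y, π₂.baseChange ℂ (T y) = LC₂ T (π₂.baseChange ℂ y) := by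
    intro T hT y
    conv_lhs => rw [← incl_proj_add_baseChange hsum y]
    rw [map_add, happlyι₁ T hT, happlyι₂ T hT, map_add, proj_incl_baseChange_eq_zero hπ₂ι₁,
      proj_incl_baseChange hπι₂, zero_add]
  have hLC₁mul : ∀ T T' : Module.End ℂ (ℂ ⊗[ℚ] U), T' ∈ spanC 𝔞 → LC₁ (T * T') = LC₁ T * LC₁ T' := by
    intro T T' hT'
    rw [hLC₁, hLC₁, hLC₁]
    exact cornerC_mul hπι₁ (hPC₁ T' hT')
  have hLC₂mul : ∀ T T' : Module.End ℂ (ℂ ⊗[ℚ] U), T' ∈ spanC 𝔞 → LC₂ (T * T') = LC₂ T * LC₂ T' := by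
    intro T T' hT'
    rw [hLC₂, hLC₂, hLC₂]
    exact cornerC_mul hπι₂ (hPC₂ T' hT')
  -- the Hodge Lie algebra `𝔥` of the second factor, its complex span, and `𝔥 ≤ 𝔤₂` (Deligne's minimality)
  set 𝔥 : Submodule ℚ (Module.End ℚ V₂) := H₂.hodgeLie with h𝔥def
  have h𝔥C : H₂.hodgeLieC = spanC 𝔥 := hodgeLieC_eq_spanC H₂
  have hΘ₂C : Θ₂ ∈ H₂.hodgeLieC := H₂.mem_hodgeLieC_of_forall_piece hΘ₂
  have h𝔥le : 𝔥 ≤ 𝔤₂ := by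
    have hΘ𝔥 : Θ₂ ∈ spanC 𝔥 := h𝔥C ▸ hΘ₂C
    have hΘ' : Θ₂ ∈ spanC (𝔤₂ ⊓ 𝔥) := by rw [spanC_inf_eq]; exact ⟨hΘ𝔤₂, hΘ𝔥⟩
    have hbr' : ∀ X ∈ 𝔤₂ ⊓ 𝔥, ∀ X' ∈ 𝔤₂ ⊓ 𝔥, X * X' - X' * X ∈ 𝔤₂ ⊓ 𝔥 :=
      fun X hX X' hX' => ⟨hbr𝔤₂ X hX.1 X' hX'.1, H₂.commutator_mem_hodgeLie hX.2 hX'.2⟩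
    exact (hodgeLie_rigid H₂ ⟨ψ₂⟩ (𝔤₂ ⊓ 𝔥) inf_le_right hbr' ⟨Θ₂, hΘ', hΘ₂⟩).trans inf_le_left
  -- `𝔞₀ = 𝔞 ∩ ker c₂` and the ideal `𝔨₁ = c₁(𝔞₀)` of `𝔤₁`
  set 𝔞₀ : Submodule ℚ (Module.End ℚ U) := 𝔞 ⊓ LinearMap.ker cL₂ with h𝔞₀
  have h𝔞₀mem : ∀ {X}, X ∈ 𝔞₀ ↔ X ∈ 𝔞 ∧ π₂ ∘ₗ X ∘ₗ ι₂ = 0 := by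
    intro X
    rw [h𝔞₀, Submodule.mem_inf, LinearMap.mem_ker, hcL₂]
  have h𝔞₀ideal : ∀ X' ∈ 𝔞, ∀ X ∈ 𝔞₀, X' * X - X * X' ∈ 𝔞₀ := by
    intro X' hX' X hX
    obtain ⟨hX𝔞, hc₂X⟩ := h𝔞₀mem.1 hX
    refine h𝔞₀mem.2 ⟨hbr X' hX' X hX𝔞, ?_⟩
    rw [hc₂br X' hX' X hX𝔞, hc₂X, mul_zero, zero_mul, sub_zero]
  set 𝔨₁ : Submodule ℚ (Module.End ℚ V₁) := 𝔞₀.map cL₁ with h𝔨₁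
  have h𝔨₁mem : ∀ {Y}, Y ∈ 𝔨₁ ↔ ∃ X ∈ 𝔞₀, π₁ ∘ₗ X ∘ₗ ι₁ = Y := by
    intro Y
    rw [h𝔨₁, Submodule.mem_map]
    simp only [hcL₁]
  have h𝔨₁le : 𝔨₁ ≤ 𝔤₁ := Submodule.map_mono inf_le_left
  have h𝔨₁ideal : ∀ Y ∈ 𝔤₁, ∀ Y' ∈ 𝔨₁, Y * Y' - Y' * Y ∈ 𝔨₁ := by
    intro Y hY Y' hY'
    obtain ⟨X, hX, rfl⟩ := h𝔤₁mem.1 hY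
    obtain ⟨X', hX', rfl⟩ := h𝔨₁mem.1 hY'
    exact h𝔨₁mem.2 ⟨_, h𝔞₀ideal X hX X' hX', hc₁br X hX X' (h𝔞₀mem.1 hX').1⟩
  -- the complementary ideal `𝔤₃` and `𝔞₃ = 𝔞 ∩ c₁⁻¹(𝔤₃)`
  obtain ⟨𝔤₃, -, h𝔤₃ideal, h𝔨𝔤₃inf, h𝔨𝔤₃sup⟩ :=
    exists_ideal_compl H₁ hn heff₁ ψ₁ 𝔤₁ hbr𝔤₁ hΘ₁ hΘ𝔤₁ hskew𝔤₁ h𝔨₁le h𝔨₁ideal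
  set 𝔞₃ : Submodule ℚ (Module.End ℚ U) := 𝔞 ⊓ 𝔤₃.comap cL₁ with h𝔞₃
  have h𝔞₃mem : ∀ {X}, X ∈ 𝔞₃ ↔ X ∈ 𝔞 ∧ π₁ ∘ₗ X ∘ₗ ι₁ ∈ 𝔤₃ := by
    intro X
    rw [h𝔞₃, Submodule.mem_inf, Submodule.mem_comap, hcL₁]
  have h𝔞₃le : 𝔞₃ ≤ 𝔞 := inf_le_left
  have h𝔞₃ideal : ∀ X' ∈ 𝔞, ∀ X ∈ 𝔞₃, X' * X - X * X' ∈ 𝔞₃ := by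
    intro X' hX' X hX
    obtain ⟨hX𝔞, hc₁X⟩ := h𝔞₃mem.1 hX
    refine h𝔞₃mem.2 ⟨hbr X' hX' X hX𝔞, ?_⟩
    rw [hc₁br X' hX' X hX𝔞]
    exact h𝔤₃ideal _ (h𝔤₁mem.2 ⟨X', hX', rfl⟩) _ hc₁X
  -- `c₂` is injective on `𝔞₃` (`𝔨₁ ∩ 𝔤₃ = 0` and the block decomposition of `X`)
  have h𝔞₃inj : ∀ X ∈ 𝔞₃, cL₂ X = 0 → X = 0 := by
    intro X hX h0
    obtain ⟨hX𝔞, hc₁X⟩ := h𝔞₃mem.1 hX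
    have hX0 : X ∈ 𝔞₀ := h𝔞₀mem.2 ⟨hX𝔞, by rw [← hcL₂]; exact h0⟩
    have hzero : π₁ ∘ₗ X ∘ₗ ι₁ ∈ 𝔨₁ ⊓ 𝔤₃ := Submodule.mem_inf.2 ⟨h𝔨₁mem.2 ⟨X, hX0, rfl⟩, hc₁X⟩
    rw [h𝔨𝔤₃inf, Submodule.mem_bot] at hzero
    rw [eq_incl_corner_add hπι₁ hπι₂ hsum (hP₁ X hX𝔞) (hP₂ X hX𝔞), hzero, (h𝔞₀mem.1 hX0).2]
    simp only [LinearMap.zero_comp, LinearMap.comp_zero, add_zero]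
  -- `𝔞 ⊆ 𝔞₀ + 𝔞₃`, so `𝔤₂ = c₂(𝔞) ⊆ c₂(𝔞₃)`
  have h𝔞le : 𝔞 ≤ 𝔞₀ ⊔ 𝔞₃ := by
    intro X hX
    have hc₁ : π₁ ∘ₗ X ∘ₗ ι₁ ∈ 𝔨₁ ⊔ 𝔤₃ := by rw [h𝔨𝔤₃sup]; exact h𝔤₁mem.2 ⟨X, hX, rfl⟩
    obtain ⟨k, hk, g, hg, hkg⟩ := Submodule.mem_sup.1 hc₁
    obtain ⟨X₀, hX₀, rfl⟩ := h𝔨₁mem.1 hk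
    have hX₀𝔞 : X₀ ∈ 𝔞 := (h𝔞₀mem.1 hX₀).1
    refine Submodule.mem_sup.2 ⟨X₀, hX₀, X - X₀, h𝔞₃mem.2 ⟨Submodule.sub_mem _ hX hX₀𝔞, ?_⟩, by abel⟩
    have e : π₁ ∘ₗ (X - X₀) ∘ₗ ι₁ = g := by
      rw [LinearMap.sub_comp, LinearMap.comp_sub, ← hkg]
      abel
    rw [e]
    exact hg
  have h𝔤₂le : 𝔤₂ ≤ 𝔞₃.map cL₂ := by
    intro Y hY
    obtain ⟨X, hX, rfl⟩ := h𝔤₂mem.1 hY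
    obtain ⟨X₀, hX₀, X₃, hX₃, rfl⟩ := Submodule.mem_sup.1 (h𝔞le hX)
    refine Submodule.mem_map.2 ⟨X₃, hX₃, ?_⟩
    rw [hcL₂, LinearMap.add_comp, LinearMap.comp_add, (h𝔞₀mem.1 hX₀).2, zero_add]
  -- `𝔞₃' = 𝔞₃ ∩ c₂⁻¹(𝔥)`: a bracket-closed rational algebra mapped by `c₂` ONTO `𝔥`
  set 𝔞₃' : Submodule ℚ (Module.End ℚ U) := 𝔞₃ ⊓ 𝔥.comap cL₂ with h𝔞₃'
  have h𝔞₃'mem : ∀ {X}, X ∈ 𝔞₃' ↔ X ∈ 𝔞₃ ∧ cL₂ X ∈ 𝔥 := by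
    intro X
    rw [h𝔞₃', Submodule.mem_inf, Submodule.mem_comap]
  have h𝔞₃'le : 𝔞₃' ≤ 𝔞₃ := inf_le_left
  have h𝔞₃'le𝔞 : 𝔞₃' ≤ 𝔞 := h𝔞₃'le.trans h𝔞₃le
  have h𝔞₃'leC : spanC 𝔞₃' ≤ spanC 𝔞 := spanC_mono h𝔞₃'le𝔞
  have hbr𝔞₃' : ∀ X ∈ 𝔞₃', ∀ X' ∈ 𝔞₃', X * X' - X' * X ∈ 𝔞₃' := by
    intro X hX X' hX'
    obtain ⟨hX₃, hXh⟩ := h𝔞₃'mem.1 hX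
    obtain ⟨hX'₃, hX'h⟩ := h𝔞₃'mem.1 hX'
    refine h𝔞₃'mem.2 ⟨h𝔞₃ideal X (h𝔞₃le hX₃) X' hX'₃, ?_⟩
    rw [hcL₂, hc₂br X (h𝔞₃le hX₃) X' (h𝔞₃le hX'₃)]
    rw [hcL₂] at hXh hX'h
    exact H₂.commutator_mem_hodgeLie hXh hX'h
  have h𝔞₃'map : 𝔞₃'.map cL₂ = 𝔥 := by
    apply le_antisymm
    · rintro _ ⟨X, hX, rfl⟩
      exact (h𝔞₃'mem.1 hX).2
    · intro Z hZ
      obtain ⟨X, hX, hXZ⟩ := Submodule.mem_map.1 (h𝔤₂le (h𝔥le hZ))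
      exact Submodule.mem_map.2 ⟨X, h𝔞₃'mem.2 ⟨hX, by rw [hXZ]; exact hZ⟩, hXZ⟩
  have h𝔞₃'injC : ∀ T ∈ spanC 𝔞₃', LC₂ T = 0 → T = 0 := fun T hT hT0 =>
    eq_zero_of_map_eq_zero_of_mem_spanC cL₂ LC₂ hLC₂c 𝔞₃' (fun X hX => h𝔞₃inj X (h𝔞₃'le hX)) hT hT0
  have h𝔞₃injC : ∀ T ∈ spanC 𝔞₃, LC₂ T = 0 → T = 0 := fun T hT hT0 =>
    eq_zero_of_map_eq_zero_of_mem_spanC cL₂ LC₂ hLC₂c 𝔞₃ h𝔞₃inj hT hT0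
  have hLC₂memC : ∀ T ∈ spanC 𝔞₃', LC₂ T ∈ H₂.hodgeLieC := fun T hT => by
    rw [h𝔥C, ← h𝔞₃'map]
    exact map_mem_spanC_map cL₂ LC₂ hLC₂c 𝔞₃' hT
  -- `c₂ : (𝔞₃')_ℂ ≅ 𝔥_ℂ` and `ρ = c₁ ∘ c₂⁻¹`
  set f₃ : ↥(spanC 𝔞₃') →ₗ[ℂ] ↥(H₂.hodgeLieC) :=
    (LC₂.domRestrict (spanC 𝔞₃')).codRestrict H₂.hodgeLieC (fun T => hLC₂memC T.1 T.2) with hf₃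
  have hf₃apply : ∀ T : ↥(spanC 𝔞₃'), (f₃ T : Module.End ℂ (ℂ ⊗[ℚ] V₂)) = LC₂ T := fun T => rfl
  have hf₃inj : Function.Injective f₃ := by
    intro T T' h
    have h' : LC₂ (T : Module.End ℂ (ℂ ⊗[ℚ] U)) = LC₂ (T' : Module.End ℂ (ℂ ⊗[ℚ] U)) := by
      rw [← hf₃apply, ← hf₃apply, h]
    apply Subtype.ext
    have h0 := h𝔞₃'injC _ (Submodule.sub_mem _ T.2 T'.2) (by rw [map_sub, h', sub_self])
    exact sub_eq_zero.1 h0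
  have hf₃surj : Function.Surjective f₃ := by
    rintro ⟨Y, hY⟩
    have hY' : Y ∈ spanC (𝔞₃'.map cL₂) := by rw [h𝔞₃'map, ← h𝔥C]; exact hY
    obtain ⟨T, hT, hTY⟩ := exists_mem_spanC_map_eq cL₂ LC₂ hLC₂c 𝔞₃' hY'
    exact ⟨⟨T, hT⟩, Subtype.ext (by rw [hf₃apply]; exact hTY)⟩
  obtain ⟨eqv, heqv⟩ : ∃ e : ↥(spanC 𝔞₃') ≃ₗ[ℂ] ↥(H₂.hodgeLieC), ∀ T, (e T : Module.End ℂ (ℂ ⊗[ℚ] V₂)) = LC₂ T :=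
    ⟨LinearEquiv.ofBijective f₃ ⟨hf₃inj, hf₃surj⟩, fun T => rfl⟩
  obtain ⟨K𝔥, hK𝔥⟩ := Submodule.exists_isCompl (H₂.hodgeLieC)
  obtain ⟨ρ, hρdef⟩ : ∃ ρ : Module.End ℂ (ℂ ⊗[ℚ] V₂) →ₗ[ℂ] Module.End ℂ (ℂ ⊗[ℚ] V₁),
      ∀ Y, ρ Y = LC₁ ((eqv.symm (Submodule.projectionOnto (H₂.hodgeLieC) K𝔥 hK𝔥 Y) : ↥(spanC 𝔞₃')) :
        Module.End ℂ (ℂ ⊗[ℚ] U)) :=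
    ⟨LC₁ ∘ₗ (spanC 𝔞₃').subtype ∘ₗ eqv.symm.toLinearMap ∘ₗ Submodule.projectionOnto (H₂.hodgeLieC) K𝔥 hK𝔥,
      fun Y => rfl⟩
  have hρ : ∀ Y ∈ H₂.hodgeLieC, ∃ T ∈ spanC 𝔞₃', LC₂ T = Y ∧ ρ Y = LC₁ T := by
    intro Y hY
    refine ⟨(eqv.symm ⟨Y, hY⟩ : ↥(spanC 𝔞₃')), (eqv.symm ⟨Y, hY⟩).2, ?_, ?_⟩
    · rw [← heqv, LinearEquiv.apply_symm_apply]
    · rw [hρdef, Submodule.projectionOnto_apply_of_mem_left hK𝔥 hY]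
  have hρT : ∀ T ∈ spanC 𝔞₃', ρ (LC₂ T) = LC₁ T := by
    intro T hT
    obtain ⟨T', hT', hT'Y, hρY⟩ := hρ (LC₂ T) (hLC₂memC T hT)
    have hTT' : T' = T := by
      have h := h𝔞₃'injC (T' - T) (Submodule.sub_mem _ hT' hT) (by rw [map_sub, hT'Y, sub_self])
      exact sub_eq_zero.1 h
    rw [hρY, hTT']
  -- elements of `(𝔞₃)_ℂ` with second corner in `𝔥_ℂ` lie in `(𝔞₃')_ℂ`
  have hlift : ∀ T ∈ spanC 𝔞₃, LC₂ T ∈ H₂.hodgeLieC → T ∈ spanC 𝔞₃' := by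
    intro T hT hTh
    obtain ⟨T', hT', hT'Y, -⟩ := hρ (LC₂ T) hTh
    have hTT' : T' = T := by
      have h := h𝔞₃injC (T' - T) (Submodule.sub_mem _ (spanC_mono h𝔞₃'le hT') hT) (by rw [map_sub, hT'Y, sub_self])
      exact sub_eq_zero.1 h
    rw [← hTT']
    exact hT'
  -- `ρ` preserves brackets on `𝔥_ℂ` and transports `ad Θ₂` to `ad Θ₁`
  have hρbr : ∀ Y ∈ H₂.hodgeLieC, ∀ Y' ∈ H₂.hodgeLieC, ρ (Y * Y' - Y' * Y) = ρ Y * ρ Y' - ρ Y' * ρ Y := by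
    intro Y hY Y' hY'
    obtain ⟨T, hT, rfl, hρY⟩ := hρ Y hY
    obtain ⟨T', hT', rfl, hρY'⟩ := hρ Y' hY'
    have hTT' : T * T' - T' * T ∈ spanC 𝔞₃' := bracket_mem_spanC_of_forall hbr𝔞₃' hT hT'
    rw [hρY, hρY', ← hLC₂mul T T' (h𝔞₃'leC hT'), ← hLC₂mul T' T (h𝔞₃'leC hT), ← map_sub, hρT _ hTT', map_sub,
      hLC₁mul T T' (h𝔞₃'leC hT'), hLC₁mul T' T (h𝔞₃'leC hT)]
  have hρΘ : ∀ Y ∈ H₂.hodgeLieC, ρ (Θ₂ * Y - Y * Θ₂) = Θ₁ * ρ Y - ρ Y * Θ₁ := by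
    intro Y hY
    obtain ⟨T, hT, rfl, hρY⟩ := hρ Y hY
    have hbrT : ΘU * T - T * ΘU ∈ spanC 𝔞₃ :=
      bracket_mem_spanC_of_forall h𝔞₃ideal hΘU𝔞 (spanC_mono h𝔞₃'le hT)
    have hbrT₂ : LC₂ (ΘU * T - T * ΘU) = Θ₂ * LC₂ T - LC₂ T * Θ₂ := by
      rw [map_sub, hLC₂mul ΘU T (h𝔞₃'leC hT), hLC₂mul T ΘU hΘU𝔞, hΘ₂eq]
    have hbrT' : ΘU * T - T * ΘU ∈ spanC 𝔞₃' := hlift _ hbrT (by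
      rw [hbrT₂]; exact H₂.commutator_mem_hodgeLieC hΘ₂C (hLC₂memC T hT))
    rw [hρY, ← hbrT₂, hρT _ hbrT', map_sub, hLC₁mul ΘU T (h𝔞₃'leC hT), hLC₁mul T ΘU hΘU𝔞, hΘ₁eq]
  -- THE BLOCKS `T_k` of `V₂ ⊗ ℂ`: forms, gradings, projections, extension operators
  obtain ⟨hPmem₂, hQmem₂, hΘ10, hΘ01, -⟩ := UnitaryTheta.theta_facts H₂ hn heff₂ hΘ₂
  have hodd : Odd n := by rw [hn]; exact odd_one
  set ω := ψ₂.form.baseChange ℂ with hω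
  have hωalt : ∀ x y, ω x y = -ω y x := fun x y => form_baseChange_swap_of_odd H₂ hodd ψ₂ y x
  have hΘskew : ∀ x y, ω (Θ₂ x) y + ω x (Θ₂ y) = 0 := fun x y => by
    rw [hω, formBaseChange_skew_of_mem_hodgeLieC ψ₂ hΘ₂C x y, neg_add_cancel]
  have horth : ∀ j k, j ≠ k → ∀ x ∈ Tb k, ∀ y ∈ Tb j, ω x y = 0 := fun j k hjk x hx y hy =>
    hTorth k j (Ne.symm hjk) x hx y hy
  obtain ⟨pr, hpr1, hpr2, hpr3, hpr4⟩ := Blocks.exists_proj_iso Tb hint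
  -- restricted data on a block
  set ωb : ∀ k, LinearMap.BilinForm ℂ ↥(Tb k) := fun k => ω.compl₁₂ (Tb k).subtype (Tb k).subtype with hωb
  have hωb_apply : ∀ k (x y : Tb k), ωb k x y = ω (x : ℂ ⊗[ℚ] V₂) y := fun k x y => rfl
  have hωbnd : ∀ k, (ωb k).Nondegenerate := by
    intro k
    have hsepL : ∀ x : Tb k, (∀ y : Tb k, ωb k x y = 0) → x = 0 := fun x hx => by
      apply Subtype.ext
      refine ψ₂.nondegenerate_baseChange.1 _ fun w => ?_
      change ω (x : ℂ ⊗[ℚ] V₂) w = 0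
      conv_lhs => rw [← hpr3 w]
      rw [map_sum]
      refine Finset.sum_eq_zero fun j _ => ?_
      by_cases hjk : j = k
      · subst hjk
        exact hx (pr j w)
      · exact horth j k hjk _ x.2 _ (pr j w).2
    exact ⟨fun x hx => hsepL x hx, fun y hy => hsepL y fun x => by rw [hωb_apply, hωalt, ← hωb_apply, hy x, neg_zero]⟩
  have hωbalt : ∀ k (x y : Tb k), ωb k x y = -ωb k y x := fun k x y => by rw [hωb_apply, hωb_apply, hωalt]
  set TΘ : ∀ k, Module.End ℂ ↥(Tb k) := fun k => Θ₂.restrict fun x hx => hYT Θ₂ hΘ₂C k x hx with hTΘ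
  have hTΘ_coe : ∀ k (x : Tb k), ((TΘ k x : Tb k) : ℂ ⊗[ℚ] V₂) = Θ₂ x := fun k x => rfl
  have hTT : ∀ k (v : Tb k), TΘ k (TΘ k v) = v := fun k v => Subtype.ext (by rw [hTΘ_coe, hTΘ_coe, hΘΘ₂])
  have hTskew : ∀ k (x y : Tb k), ωb k (TΘ k x) y + ωb k x (TΘ k y) = 0 := fun k x y => by
    rw [hωb_apply, hωb_apply, hTΘ_coe, hTΘ_coe]; exact hΘskew _ _
  set Pb : ∀ k, Submodule ℂ ↥(Tb k) := fun k => (H₂.piece 1 0).comap (Tb k).subtype with hPb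
  set Qb : ∀ k, Submodule ℂ ↥(Tb k) := fun k => (H₂.piece 0 1).comap (Tb k).subtype with hQb
  have hP : ∀ k, ∀ x ∈ Pb k, TΘ k x = x := fun k x hx => Subtype.ext (by rw [hTΘ_coe]; exact hΘ10 _ hx)
  have hQ : ∀ k, ∀ x ∈ Qb k, TΘ k x = -x := fun k x hx =>
    Subtype.ext (by rw [hTΘ_coe, Submodule.coe_neg]; exact hΘ01 _ hx)
  have hPmem : ∀ k (v : Tb k), (2 : ℂ)⁻¹ • (v + TΘ k v) ∈ Pb k := fun k v => by
    change (((2 : ℂ)⁻¹ • (v + TΘ k v) : Tb k) : ℂ ⊗[ℚ] V₂) ∈ H₂.piece 1 0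
    rw [Submodule.coe_smul, Submodule.coe_add, hTΘ_coe]
    exact hPmem₂ _
  have hQmem : ∀ k (v : Tb k), (2 : ℂ)⁻¹ • (v - TΘ k v) ∈ Qb k := fun k v => by
    change (((2 : ℂ)⁻¹ • (v - TΘ k v) : Tb k) : ℂ ⊗[ℚ] V₂) ∈ H₂.piece 0 1
    rw [Submodule.coe_smul, Submodule.coe_sub, hTΘ_coe]
    exact hQmem₂ _
  -- the skew operators of a block
  have h𝔰b : ∀ k, ∃ 𝔰 : Submodule ℂ (Module.End ℂ ↥(Tb k)), ∀ g, g ∈ 𝔰 ↔ ∀ x y, ωb k (g x) y + ωb k x (g y) = 0 := by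
    intro k
    exact
      ⟨{ carrier := {g | ∀ x y, ωb k (g x) y + ωb k x (g y) = 0}
         zero_mem' := fun x y => by simp
         add_mem' := fun {g g'} hg hg' x y => by
           simp only [LinearMap.add_apply, map_add]
           linear_combination hg x y + hg' x y
         smul_mem' := fun c g hg x y => by
           simp only [LinearMap.smul_apply, map_smul, smul_eq_mul]
           linear_combination c * hg x y }, fun g => Iff.rfl⟩
  choose 𝔰b h𝔰b using h𝔰b
  -- the extension `ext_k g = sub_k ∘ g ∘ p_k` of a block operator to `V₂ ⊗ ℂ`
  have hext : ∀ k, ∃ L : Module.End ℂ ↥(Tb k) →ₗ[ℂ] Module.End ℂ (ℂ ⊗[ℚ] V₂), ∀ g, L g = (Tb k).subtype ∘ₗ g ∘ₗ pr k := by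
    intro k
    exact
      ⟨{ toFun := fun g => (Tb k).subtype ∘ₗ g ∘ₗ pr k
         map_add' := fun g g' => by rw [LinearMap.add_comp, LinearMap.comp_add]
         map_smul' := fun c g => by rw [LinearMap.smul_comp, LinearMap.comp_smul, RingHom.id_apply] }, fun g => rfl⟩
  choose ext hext using hext
  have hext_apply : ∀ k g x, ext k g x = ((g (pr k x) : Tb k) : ℂ ⊗[ℚ] V₂) := fun k g x => by
    rw [hext]; rfl
  have hext_mem : ∀ k g (x : Tb k), ext k g x = ((g x : Tb k) : ℂ ⊗[ℚ] V₂) := fun k g x => by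
    rw [hext_apply, hpr1]
  have hext_zero : ∀ k j, j ≠ k → ∀ g, ∀ x ∈ Tb j, ext k g x = 0 := fun k j hjk g x hx => by
    rw [hext_apply, hpr2 k j hjk x hx, map_zero, Submodule.coe_zero]
  have hext_mapsTo : ∀ k g j, Set.MapsTo (ext k g) (Tb j) (Tb j) := by
    intro k g j x hx
    by_cases hjk : j = k
    · rw [hjk] at hx ⊢
      change ext k g x ∈ Tb k
      rw [hext_mem k g ⟨x, hx⟩]
      exact (g ⟨x, hx⟩).2
    · change ext k g x ∈ Tb j
      rw [hext_zero k j hjk g x hx]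
      exact (Tb j).zero_mem
  -- orthogonality of `T_k` to the value of a vector minus its `k`-th component
  have horth' : ∀ k (t : Tb k) (y : ℂ ⊗[ℚ] V₂), ω (t : ℂ ⊗[ℚ] V₂) y = ω (t : ℂ ⊗[ℚ] V₂) (pr k y : Tb k) := by
    intro k t y
    conv_lhs => rw [← hpr3 y]
    rw [map_sum, Finset.sum_eq_single k]
    · intro j _ hjk
      exact horth j k hjk _ t.2 _ (pr j y).2
    · intro hk; exact absurd (Finset.mem_univ k) hk
  have horth'' : ∀ k (x : ℂ ⊗[ℚ] V₂) (t : Tb k), ω x (t : ℂ ⊗[ℚ] V₂) = ω (pr k x : Tb k) (t : ℂ ⊗[ℚ] V₂) := by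
    intro k x t
    rw [hωalt, horth' k t x, hωalt, neg_neg]
  have hext_skew : ∀ k, ∀ g ∈ 𝔰b k, ∀ x y, ω (ext k g x) y + ω x (ext k g y) = 0 := by
    intro k g hg x y
    rw [hext_apply, hext_apply, horth' k (g (pr k x)) y, horth'' k x (g (pr k y)), ← hωb_apply, ← hωb_apply]
    exact (h𝔰b k g).1 hg _ _
  have hext_mul : ∀ k g g', ext k g * ext k g' = ext k (g * g') := by
    intro k g g'
    apply LinearMap.ext
    intro x
    rw [Module.End.mul_apply, hext_apply, hext_apply, hext_apply, Module.End.mul_apply, hpr1]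
  have hext_mul_ne : ∀ k j, j ≠ k → ∀ g g', ext k g * ext j g' = 0 := by
    intro k j hjk g g'
    apply LinearMap.ext
    intro x
    rw [Module.End.mul_apply, hext_apply j g' x, hext_zero k j hjk g _ (g' (pr j x)).2, LinearMap.zero_apply]
  have hext_TΘ : ∀ k g, ext k (TΘ k * g - g * TΘ k) = Θ₂ * ext k g - ext k g * Θ₂ := by
    intro k g
    have hprΘ : ∀ x, TΘ k (pr k x) = pr k (Θ₂ x) := fun x =>
      Subtype.ext (by rw [hTΘ_coe, hpr4 Θ₂ (fun j y hy => hYT Θ₂ hΘ₂C j y hy)])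
    apply LinearMap.ext
    intro x
    simp only [LinearMap.sub_apply, Module.End.mul_apply, hext_apply, Submodule.coe_sub, hTΘ_coe, hprΘ]
  -- restriction of a block-preserving operator and its block decomposition
  have hrestr : ∀ Y : Module.End ℂ (ℂ ⊗[ℚ] V₂), ∀ hYm : ∀ k, Set.MapsTo Y (Tb k) (Tb k),
      Y = ∑ k, ext k (Y.restrict fun x hx => hYm k hx) := by
    intro Y hYm
    apply LinearMap.ext
    intro x
    rw [LinearMap.sum_apply]
    conv_lhs => rw [← hpr3 x, map_sum]
    refine Finset.sum_congr rfl fun k _ => ?_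
    rw [hext_apply, LinearMap.coe_restrict_apply]
  have hrestr_skew : ∀ Y (hY : Y ∈ H₂.hodgeLieC) (k : ιp × Fin 2),
      Y.restrict (fun x hx => hYT Y hY k x hx) ∈ 𝔰b k := by
    intro Y hY k
    rw [h𝔰b]
    intro x y
    rw [hωb_apply, hωb_apply, LinearMap.coe_restrict_apply, LinearMap.coe_restrict_apply, hω,
      formBaseChange_skew_of_mem_hodgeLieC ψ₂ hY, neg_add_cancel]
  -- the gluing maps `u_i : T_(i,0) ⥲ T_(i,1)`, `v_i : T_(i,1) ⥲ T_(i,0)`: supports and ranges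
  have hu_pr : ∀ i y, uu i y = uu i (pr (i, 0) y : Tb (i, 0)) := by
    intro i y
    conv_lhs => rw [← hpr3 y, map_sum]
    rw [Finset.sum_eq_single (i, 0)]
    · intro p _ hp
      exact hu0 i p hp _ (pr p y).2
    · intro h; exact absurd (Finset.mem_univ _) h
  have hu_range : ∀ i y, uu i y ∈ Tb (i, 1) := fun i y => by
    rw [hu_pr]
    exact huT i _ (pr (i, 0) y).2
  have hv_pr : ∀ i y, vv i y = vv i (pr (i, 1) y : Tb (i, 1)) := by
    intro i y
    conv_lhs => rw [← hpr3 y, map_sum]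
    rw [Finset.sum_eq_single (i, 1)]
    · intro p _ hp
      exact hv0 i p hp _ (pr p y).2
    · intro h; exact absurd (Finset.mem_univ _) h
  have hv_range : ∀ i y, vv i y ∈ Tb (i, 0) := fun i y => by
    rw [hv_pr]
    exact hvT i _ (pr (i, 1) y).2
  have hpr_v : ∀ i x, ((pr (i, 0) (vv i x) : Tb (i, 0)) : ℂ ⊗[ℚ] V₂) = vv i x := fun i x =>
    congrArg Subtype.val (hpr1 (i, 0) ⟨vv i x, hv_range i x⟩)
  have h01 : ∀ i : ιp, ((i, 0) : ιp × Fin 2) ≠ (i, 1) := fun i h => by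
    have h' := (Prod.mk.inj h).2
    exact absurd h' (by decide)
  -- the doubled extension `E_i g = ext_(i,0) g + u_i ∘ ext_(i,0) g ∘ v_i` of an operator of the representative block
  have hEx : ∀ i, ∃ L : Module.End ℂ ↥(Tb (i, 0)) →ₗ[ℂ] Module.End ℂ (ℂ ⊗[ℚ] V₂),
      ∀ g, L g = ext (i, 0) g + uu i * ext (i, 0) g * vv i := by
    intro i
    exact
      ⟨{ toFun := fun g => ext (i, 0) g + uu i * ext (i, 0) g * vv i
         map_add' := fun g g' => by rw [map_add, mul_add, add_mul]; abel
         map_smul' := fun c g => by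
           simp only [map_smul, mul_smul_comm, smul_mul_assoc, RingHom.id_apply, smul_add] }, fun g => rfl⟩
  choose E hE using hEx
  have hE𝔥 : ∀ i, ∀ g ∈ 𝔰b (i, 0), E i g ∈ H₂.hodgeLieC := by
    intro i g hg
    rw [hE]
    exact hrigid i _ (fun y => by rw [hext_apply]; exact (g _).2) (fun p hp y hy => hext_zero (i, 0) p hp g y hy)
      (hext_skew (i, 0) g hg)
  have hXu : ∀ i j g, ext (i, 0) g * uu j = 0 := by
    intro i j g
    apply LinearMap.ext
    intro x
    rw [Module.End.mul_apply, hext_zero (i, 0) (j, 1) (fun h => h01 j ((Prod.mk.inj h).2 ▸ rfl)) g _ (hu_range j x),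
      LinearMap.zero_apply]
  have hvX : ∀ i j g, vv i * ext (j, 0) g = 0 := by
    intro i j g
    apply LinearMap.ext
    intro x
    rw [Module.End.mul_apply, hext_apply, hv0 i (j, 0) (fun h => h01 j ((Prod.mk.inj h).2 ▸ rfl)) _ (g _).2,
      LinearMap.zero_apply]
  have hvuX : ∀ i g, vv i * uu i * ext (i, 0) g = ext (i, 0) g := by
    intro i g
    apply LinearMap.ext
    intro x
    rw [Module.End.mul_apply, Module.End.mul_apply, hext_apply, hvu i _ (g _).2]
  have hvuX_ne : ∀ i j, j ≠ i → ∀ g, vv i * uu j * ext (j, 0) g = 0 := by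
    intro i j hji g
    apply LinearMap.ext
    intro x
    rw [Module.End.mul_apply, Module.End.mul_apply, LinearMap.zero_apply]
    exact hv0 i (j, 1) (fun h => hji (Prod.mk.inj h).1) _ (hu_range j _)
  have hE_mul : ∀ i g g', E i g * E i g' = E i (g * g') := by
    intro i g g'
    have h1 : ext (i, 0) g * (uu i * ext (i, 0) g' * vv i) = 0 := by
      rw [← mul_assoc, ← mul_assoc, hXu, zero_mul, zero_mul]
    have h2 : uu i * ext (i, 0) g * vv i * ext (i, 0) g' = 0 := by
      rw [mul_assoc, hvX, mul_zero]
    have h3 : uu i * ext (i, 0) g * vv i * (uu i * ext (i, 0) g' * vv i) = uu i * ext (i, 0) (g * g') * vv i := by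
      rw [mul_assoc (uu i * ext (i, 0) g), ← mul_assoc (vv i), ← mul_assoc (vv i), hvuX, ← mul_assoc,
        mul_assoc (uu i), hext_mul]
    rw [hE, hE, hE, add_mul, mul_add, mul_add, hext_mul, h1, h2, h3, add_zero, zero_add]
  have hE_mul_ne : ∀ i j, j ≠ i → ∀ g g', E i g * E j g' = 0 := by
    intro i j hji g g'
    have h0 : ext (i, 0) g * ext (j, 0) g' = 0 := hext_mul_ne (i, 0) (j, 0) (fun h => hji (Prod.mk.inj h).1) g g'
    have h1 : ext (i, 0) g * (uu j * ext (j, 0) g' * vv j) = 0 := by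
      rw [← mul_assoc, ← mul_assoc, hXu, zero_mul, zero_mul]
    have h2 : uu i * ext (i, 0) g * vv i * ext (j, 0) g' = 0 := by
      rw [mul_assoc, hvX, mul_zero]
    have h3 : uu i * ext (i, 0) g * vv i * (uu j * ext (j, 0) g' * vv j) = 0 := by
      rw [mul_assoc (uu i * ext (i, 0) g), ← mul_assoc (vv i), ← mul_assoc (vv i), hvuX_ne i j hji, zero_mul,
        mul_zero]
    rw [hE, hE, add_mul, mul_add, mul_add, h0, h1, h2, h3, add_zero, add_zero]
  have hE_TΘ : ∀ i g, E i (TΘ (i, 0) * g - g * TΘ (i, 0)) = Θ₂ * E i g - E i g * Θ₂ := by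
    intro i g
    have hΘu : Θ₂ * uu i = uu i * Θ₂ := h𝔥u Θ₂ hΘ₂C i
    have hΘv : Θ₂ * vv i = vv i * Θ₂ := h𝔥v Θ₂ hΘ₂C i
    have e1 : uu i * (Θ₂ * ext (i, 0) g) * vv i = Θ₂ * (uu i * ext (i, 0) g * vv i) := by
      rw [← mul_assoc (uu i), ← hΘu, mul_assoc Θ₂, mul_assoc Θ₂]
    have e2 : uu i * (ext (i, 0) g * Θ₂) * vv i = uu i * ext (i, 0) g * vv i * Θ₂ := by
      rw [← mul_assoc (uu i), mul_assoc (uu i * ext (i, 0) g), hΘv, ← mul_assoc]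
    rw [hE, hE, hext_TΘ, mul_sub, sub_mul, e1, e2, mul_add, add_mul]
    abel
  have hE_mem : ∀ i g (y : Tb (i, 0)), E i g y = ((g y : Tb (i, 0)) : ℂ ⊗[ℚ] V₂) := by
    intro i g y
    rw [hE, LinearMap.add_apply, Module.End.mul_apply, Module.End.mul_apply, hv0 i (i, 0) (h01 i) _ y.2, map_zero,
      map_zero, add_zero, hext_mem]
  have hE_u : ∀ i g (y : Tb (i, 0)), E i g (uu i y) = uu i ((g y : Tb (i, 0)) : ℂ ⊗[ℚ] V₂) := by
    intro i g y
    rw [hE, LinearMap.add_apply, Module.End.mul_apply, Module.End.mul_apply,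
      hext_zero (i, 0) (i, 1) (fun h => h01 i h.symm) g _ (huT i _ y.2), zero_add, hvu i _ y.2, hext_mem]
  -- the block decomposition of an element of `𝔥_ℂ` through the doubled extensions: `Y|_{T_(i,1)} = u_i Y|_{T_(i,0)} v_i`
  have hrestr' : ∀ Y (hY : Y ∈ H₂.hodgeLieC), Y = ∑ i, E i (Y.restrict fun x hx => hYT Y hY (i, 0) x hx) := by
    intro Y hY
    have hYm : ∀ p, Set.MapsTo Y (Tb p) (Tb p) := fun p x hx => hYT Y hY p x hx
    apply LinearMap.ext
    intro x
    rw [LinearMap.sum_apply]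
    conv_lhs => rw [← hpr3 x, map_sum, Fintype.sum_prod_type]
    refine Finset.sum_congr rfl fun i _ => ?_
    rw [Fin.sum_univ_two, hE, LinearMap.add_apply, Module.End.mul_apply, Module.End.mul_apply, hext_apply,
      hext_apply, LinearMap.coe_restrict_apply, LinearMap.coe_restrict_apply, hpr_v i x,
      ← Module.End.mul_apply (f := uu i) (g := Y), ← h𝔥u Y hY i, Module.End.mul_apply, hv_pr i x,
      huv i _ (pr (i, 1) x).2]
  -- `ρ_i = ρ ∘ E_i` on a representative block: brackets and `ad Θ`
  have hρbrk : ∀ i, ∀ g ∈ 𝔰b (i, 0), ∀ g' ∈ 𝔰b (i, 0),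
      (ρ ∘ₗ E i) (g * g' - g' * g) = (ρ ∘ₗ E i) g * (ρ ∘ₗ E i) g' - (ρ ∘ₗ E i) g' * (ρ ∘ₗ E i) g := by
    intro i g hg g' hg'
    simp only [LinearMap.comp_apply]
    have h1 : E i (g * g' - g' * g) = E i g * E i g' - E i g' * E i g := by
      rw [hE_mul, hE_mul]; exact map_sub (E i) _ _
    rw [h1, hρbr _ (hE𝔥 i g hg) _ (hE𝔥 i g' hg')]
  have hρΘk : ∀ i, ∀ g ∈ 𝔰b (i, 0),
      (ρ ∘ₗ E i) (TΘ (i, 0) * g - g * TΘ (i, 0)) = Θ₁ * (ρ ∘ₗ E i) g - (ρ ∘ₗ E i) g * Θ₁ := by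
    intro i g hg
    simp only [LinearMap.comp_apply]
    rw [hE_TΘ, hρΘ _ (hE𝔥 i g hg)]
  have hρcomm : ∀ i j, j ≠ i → ∀ g ∈ 𝔰b (i, 0), ∀ g' ∈ 𝔰b (j, 0),
      ρ (E i g) * ρ (E j g') = ρ (E j g') * ρ (E i g) := by
    intro i j hji g hg g' hg'
    have h := hρbr _ (hE𝔥 i g hg) _ (hE𝔥 j g' hg')
    rw [hE_mul_ne i j hji, hE_mul_ne j i (Ne.symm hji), sub_self, map_zero] at h
    exact (sub_eq_zero.1 h.symm)
  -- THE CLAIM: `ρ ∘ E_i` kills every `𝔰𝔭(T_(i,0))`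
  have hclaim : ∀ i, ∀ g ∈ 𝔰b (i, 0), ρ (E i g) = 0 := by
    intro i
    set k : ιp × Fin 2 := (i, 0)
    -- the empty block
    by_cases hTk : Tb k = ⊥
    · intro g _
      haveI : Subsingleton ↥(Tb k) := by
        refine ⟨fun x y => Subtype.ext ?_⟩
        have hx : (x : ℂ ⊗[ℚ] V₂) ∈ (⊥ : Submodule ℂ (ℂ ⊗[ℚ] V₂)) := hTk ▸ x.2
        have hy : (y : ℂ ⊗[ℚ] V₂) ∈ (⊥ : Submodule ℂ (ℂ ⊗[ℚ] V₂)) := hTk ▸ y.2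
        rw [(Submodule.mem_bot ℂ).1 hx, (Submodule.mem_bot ℂ).1 hy]
      have hg0 : g = 0 := Subsingleton.elim _ _
      rw [hg0, map_zero, map_zero]
    haveI : Nontrivial ↥(Tb k) := (Submodule.nontrivial_iff_ne_bot).2 hTk
    have hP0 : Pb k ≠ ⊥ := SymplecticWitness.P_ne_bot_of_nontrivial (ωb k) (hωbnd k) (hTskew k) (hPmem k)
    -- dichotomy: `ρ_k` injective on `𝔰𝔭(T_k)`, or zero
    by_cases hinj : ∀ g ∈ 𝔰b k, (ρ ∘ₗ E i) g = 0 → g = 0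
    swap
    · -- the kernel is a non-zero ideal, contains `Θ|_{T_k}`, hence is everything (§0)
      push Not at hinj
      obtain ⟨g₀, hg₀, hρg₀, hg₀0⟩ := hinj
      let I : Submodule ℂ (Module.End ℂ ↥(Tb k)) :=
        { carrier := {g | g ∈ 𝔰b k ∧ (ρ ∘ₗ E i) g = 0}
          zero_mem' := ⟨(𝔰b k).zero_mem, by rw [map_zero]⟩
          add_mem' := fun {g g'} hg hg' => ⟨(𝔰b k).add_mem hg.1 hg'.1, by rw [map_add, hg.2, hg'.2, add_zero]⟩
          smul_mem' := fun c g hg => ⟨(𝔰b k).smul_mem c hg.1, by rw [map_smul, hg.2, smul_zero]⟩ }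
      have hImem : ∀ g, g ∈ I ↔ g ∈ 𝔰b k ∧ (ρ ∘ₗ E i) g = 0 := fun g => Iff.rfl
      have hIskew : ∀ g ∈ I, ∀ x y, ωb k (g x) y + ωb k x (g y) = 0 := fun g hg => (h𝔰b k g).1 hg.1
      have hI : ∀ Z : Module.End ℂ ↥(Tb k), (∀ x y, ωb k (Z x) y + ωb k x (Z y) = 0) → ∀ g ∈ I, Z * g - g * Z ∈ I := by
        intro Z hZ g hg
        have hZ' : Z ∈ 𝔰b k := (h𝔰b k Z).2 hZ
        refine ⟨?_, ?_⟩
        · rw [h𝔰b]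
          intro x y
          simp only [LinearMap.sub_apply, Module.End.mul_apply, map_sub, LinearMap.sub_apply]
          have e1 := hZ (g x) y
          have e2 := (h𝔰b k g).1 hg.1 x (Z y)
          have e3 := (h𝔰b k g).1 hg.1 (Z x) y
          have e4 := hZ x (g y)
          linear_combination e1 - e3 + e4 - e2
        · simp only [hρbrk i Z hZ' g hg.1, hg.2, mul_zero, zero_mul, sub_self]
      have hI0 : I ≠ ⊥ := by
        intro h0
        have : g₀ ∈ I := ⟨hg₀, hρg₀⟩
        rw [h0, Submodule.mem_bot] at this
        exact hg₀0 this
      have hΘI : TΘ k ∈ I := SymplecticIdeal.theta_mem_of_ne_bot (ωb k) (hωbnd k) (hωbalt k) (hTT k) (hTskew k)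
        (hP k) (hQ k) (hPmem k) (hQmem k) I hIskew hI hI0
      intro g hg
      have h := SymplecticWitness.eq_zero_of_theta_bracket_of_bracket (ωb k) (hωbnd k) (hωbalt k) (hTT k) (hTskew k)
        (hP k) (hQ k) (hPmem k) (hQmem k) (ρ ∘ₗ E i)
        (fun Y hY => by
          simp only [hρbrk i (TΘ k) hΘI.1 Y ((h𝔰b k Y).2 hY), hΘI.2, zero_mul, mul_zero, sub_self])
        (fun Y Y' hY hY' h0 h0' => by
          simp only [hρbrk i Y ((h𝔰b k Y).2 hY) Y' ((h𝔰b k Y').2 hY'), h0, h0', zero_mul, sub_self])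
        ((h𝔰b k g).1 hg)
      simpa only [LinearMap.comp_apply] using h
    -- THE GRAPH CASE: `ρ_k` injective; the standard representation of `𝔰𝔭(T_k)` occurs in `V₁ ⊗ ℂ`
    exfalso
    obtain ⟨F, hFne, hFeq⟩ := SymplecticWitness.exists_equivariant_ne_zero (ωb k) (hωbnd k) (hωbalt k) (hTT k)
      (hTskew k) (hP k) (hQ k) (hPmem k) (hQmem k) hP0 (𝔰b k) (h𝔰b k) hΘΘ₁ (ρ ∘ₗ E i) (hρbrk i) (hρΘk i) hinj
    have hFapply : ∀ g ∈ 𝔰b k, ∀ v, ρ (E i g) (F v) = F (g v) := fun g hg v => by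
      have h := LinearMap.congr_fun (hFeq g hg) v
      simpa only [LinearMap.comp_apply] using h
    have hΘF : Θ₁ ∘ₗ F = F ∘ₗ TΘ k := SymplecticWitness.theta_comp_eq_of_equivariant (ωb k) (hωbnd k) (hωbalt k)
      (hTskew k) (hP k) (hQ k) (hPmem k) (hQmem k) (𝔰b k) (h𝔰b k) hΘΘ₁ (ρ ∘ₗ E i) (hρΘk i) F hFeq
    -- the other blocks act trivially on `F` (the `Θ`-weights, §0)
    -- the other places act trivially on `F` (the `Θ`-weights, §0 of the rigid-blocks file)
    have hother : ∀ j, j ≠ i → ∀ g ∈ 𝔰b (j, 0), ρ (E j g) ∘ₗ F = 0 := by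
      intro j hji
      obtain ⟨σL, hσL⟩ : ∃ L : Module.End ℂ ↥(Tb (j, 0)) →ₗ[ℂ] (↥(Tb k) →ₗ[ℂ] ℂ ⊗[ℚ] V₁),
          ∀ g, L g = ρ (E j g) ∘ₗ F :=
        ⟨{ toFun := fun g => ρ (E j g) ∘ₗ F
           map_add' := fun g g' => by rw [map_add, map_add, LinearMap.add_comp]
           map_smul' := fun c g => by rw [map_smul, map_smul, LinearMap.smul_comp, RingHom.id_apply] }, fun g => rfl⟩
      intro g hg
      rw [← hσL]
      refine SymplecticWitness.eq_zero_of_theta_bracket_of_bracket (ωb (j, 0)) (hωbnd (j, 0)) (hωbalt (j, 0))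
        (hTT (j, 0)) (hTskew (j, 0)) (hP (j, 0)) (hQ (j, 0)) (hPmem (j, 0)) (hQmem (j, 0)) σL (fun Y hY => ?_)
        (fun Y Y' hY hY' h0 h0' => ?_) ((h𝔰b (j, 0) g).1 hg)
      · -- `σ[Θ_j, Y] = Θ₁ G - G Θ_k = 0` for the `ρ_i`-equivariant `G = ρ(E_j Y) F`
        have hY' : Y ∈ 𝔰b (j, 0) := (h𝔰b (j, 0) Y).2 hY
        have hGeq : ∀ g' ∈ 𝔰b k, (ρ ∘ₗ E i) g' ∘ₗ (ρ (E j Y) ∘ₗ F) = (ρ (E j Y) ∘ₗ F) ∘ₗ g' := by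
          intro g' hg'
          rw [LinearMap.comp_apply, ← LinearMap.comp_assoc, ← Module.End.mul_eq_comp, hρcomm i j hji g' hg' Y hY',
            Module.End.mul_eq_comp, LinearMap.comp_assoc, ← LinearMap.comp_apply (f := ρ) (g := E i), hFeq g' hg',
            LinearMap.comp_assoc]
        have hΘG := SymplecticWitness.theta_comp_eq_of_equivariant (ωb k) (hωbnd k) (hωbalt k) (hTskew k) (hP k) (hQ k)
          (hPmem k) (hQmem k) (𝔰b k) (h𝔰b k) hΘΘ₁ (ρ ∘ₗ E i) (hρΘk i) _ hGeq
        rw [hσL, ← LinearMap.comp_apply (f := ρ) (g := E j), hρΘk j Y hY', LinearMap.comp_apply, LinearMap.sub_comp,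
          Module.End.mul_eq_comp, Module.End.mul_eq_comp, LinearMap.comp_assoc F (ρ (E j Y)) Θ₁,
          LinearMap.comp_assoc F Θ₁ (ρ (E j Y)), hΘF, ← LinearMap.comp_assoc (TΘ k) F (ρ (E j Y)), hΘG, sub_self]
      · rw [hσL, ← LinearMap.comp_apply (f := ρ) (g := E j), hρbrk j Y ((h𝔰b (j, 0) Y).2 hY) Y' ((h𝔰b (j, 0) Y').2 hY'),
          LinearMap.comp_apply, LinearMap.comp_apply, LinearMap.sub_comp, Module.End.mul_eq_comp, Module.End.mul_eq_comp,
          LinearMap.comp_assoc F (ρ (E j Y')) (ρ (E j Y)), LinearMap.comp_assoc F (ρ (E j Y)) (ρ (E j Y'))]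
        rw [hσL] at h0 h0'
        rw [h0, h0', LinearMap.comp_zero, LinearMap.comp_zero, sub_self]
    obtain ⟨Fm, hFm⟩ : ∃ Fm : ℂ ⊗[ℚ] V₂ →ₗ[ℂ] ℂ ⊗[ℚ] V₁, Fm = F ∘ₗ pr k := ⟨_, rfl⟩
    obtain ⟨Z', hZ'⟩ : ∃ Z' : Module.End ℂ (ℂ ⊗[ℚ] U), Z' = ι₁.baseChange ℂ ∘ₗ Fm ∘ₗ π₂.baseChange ℂ :=
      ⟨_, rfl⟩
    have hcommZ' : ∀ T ∈ spanC 𝔞, LC₁ T ∘ₗ Fm = Fm ∘ₗ LC₂ T → T * Z' = Z' * T := by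
      intro T hT hTF
      apply LinearMap.ext
      intro y
      rw [Module.End.mul_apply, Module.End.mul_apply, hZ', LinearMap.comp_apply, LinearMap.comp_apply,
        happlyι₁ T hT, LinearMap.comp_apply, LinearMap.comp_apply, hprojT₂ T hT, ← LinearMap.comp_apply (f := LC₁ T),
        hTF, LinearMap.comp_apply]
    have hρFm : ∀ Y ∈ H₂.hodgeLieC, ρ Y ∘ₗ Fm = Fm ∘ₗ Y := by
      intro Y hY
      have hYm : ∀ j, Set.MapsTo Y (Tb j) (Tb j) := fun j x hx => hYT Y hY j x hx
      have hdec := hrestr' Y hY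
      apply LinearMap.ext
      intro x
      rw [LinearMap.comp_apply, LinearMap.comp_apply, hFm, LinearMap.comp_apply, LinearMap.comp_apply]
      conv_lhs => rw [hdec, map_sum, LinearMap.sum_apply]
      rw [Finset.sum_eq_single i]
      · rw [hFapply _ (hrestr_skew Y hY k)]
        congr 1
        apply Subtype.ext
        rw [LinearMap.coe_restrict_apply, hpr4 Y hYm]
      · intro j _ hji
        rw [← LinearMap.comp_apply, hother j hji _ (hrestr_skew Y hY (j, 0)), LinearMap.zero_apply]
      · intro hi; exact absurd (Finset.mem_univ i) hi
    have hcomm₃ : ∀ T ∈ spanC 𝔞₃', T * Z' = Z' * T := by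
      intro T hT
      refine hcommZ' T (h𝔞₃'leC hT) ?_
      rw [← hρT T hT]
      exact hρFm _ (hLC₂memC T hT)
    -- descent: `Z'` lies in the complex span of the RATIONAL operators commuting with `𝔞₃'` ...
    have hZ'span := mem_span_baseChange_of_forall_commute (𝔞₃' : Set (Module.End ℚ U)) (Y := Z')
      (fun X hX => (hcomm₃ _ (baseChange_mem_spanC hX)).symm)
    -- ... whose `(1,2)`-blocks vanish by `Hom = 0`: they are `ρ`-equivariant on `𝔥_ℂ`, hence intertwine `Θ₂`, `Θ₁`
    have hblock : ∀ Z : Module.End ℚ U, (∀ X ∈ (𝔞₃' : Set (Module.End ℚ U)), Z * X = X * Z) →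
        π₁ ∘ₗ Z ∘ₗ ι₂ = 0 := by
      intro Z hZ
      have hZC : ∀ T ∈ spanC 𝔞₃', T * Z.baseChange ℂ = Z.baseChange ℂ * T := fun T hT =>
        (commute_of_mem_spanC (𝔤 := 𝔞₃') (T := Z.baseChange ℂ) (fun X hX => by
          rw [← LinearMap.baseChange_mul, hZ X hX, LinearMap.baseChange_mul]) hT).symm
      set f := (π₁ ∘ₗ Z ∘ₗ ι₂).baseChange ℂ with hf
      have hfT : ∀ T ∈ spanC 𝔞₃', ∀ x, f (LC₂ T x) = LC₁ T (f x) := by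
        intro T hT x
        have hT𝔞 : T ∈ spanC 𝔞 := h𝔞₃'leC hT
        rw [hf, LinearMap.baseChange_comp, LinearMap.baseChange_comp, LinearMap.comp_apply, LinearMap.comp_apply,
          LinearMap.comp_apply, LinearMap.comp_apply, ← happlyι₂ T hT𝔞, ← Module.End.mul_apply (f := Z.baseChange ℂ),
          ← hZC T hT, Module.End.mul_apply, hprojT₁ T hT𝔞]
      have hfY : ∀ Y ∈ H₂.hodgeLieC, ∀ x, f (Y x) = ρ Y (f x) := by
        intro Y hY x
        obtain ⟨T, hT, rfl, hρY⟩ := hρ Y hY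
        rw [hρY, hfT T hT]
      -- block by block: `f|_{T_j}` is `ρ_j`-equivariant, hence intertwines the gradings
      -- block by block: `f|_{T_(j,0)}` and `f ∘ u_j|_{T_(j,0)}` are `ρ_j`-equivariant, hence intertwine the gradings
      have hΘf0 : ∀ j (x : Tb (j, 0)), Θ₁ (f x) = f (Θ₂ x) := by
        intro j x
        have hfj : ∀ g ∈ 𝔰b (j, 0), (ρ ∘ₗ E j) g ∘ₗ (f ∘ₗ (Tb (j, 0)).subtype) = (f ∘ₗ (Tb (j, 0)).subtype) ∘ₗ g := by
          intro g hg
          apply LinearMap.ext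
          intro y
          rw [LinearMap.comp_apply, LinearMap.comp_apply, LinearMap.comp_apply, LinearMap.comp_apply,
            LinearMap.comp_apply, Submodule.subtype_apply, Submodule.subtype_apply, ← hfY _ (hE𝔥 j g hg), hE_mem]
        have h := SymplecticWitness.theta_comp_eq_of_equivariant (ωb (j, 0)) (hωbnd (j, 0)) (hωbalt (j, 0))
          (hTskew (j, 0)) (hP (j, 0)) (hQ (j, 0)) (hPmem (j, 0)) (hQmem (j, 0)) (𝔰b (j, 0)) (h𝔰b (j, 0)) hΘΘ₁
          (ρ ∘ₗ E j) (hρΘk j) _ hfj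
        have h' := LinearMap.congr_fun h x
        simpa only [LinearMap.comp_apply, Submodule.subtype_apply, hTΘ_coe] using h'
      have hΘf1 : ∀ j (x : Tb (j, 1)), Θ₁ (f x) = f (Θ₂ x) := by
        intro j x
        have hGj : ∀ g ∈ 𝔰b (j, 0), (ρ ∘ₗ E j) g ∘ₗ (f ∘ₗ uu j ∘ₗ (Tb (j, 0)).subtype) =
            (f ∘ₗ uu j ∘ₗ (Tb (j, 0)).subtype) ∘ₗ g := by
          intro g hg
          apply LinearMap.ext
          intro y
          rw [LinearMap.comp_apply, LinearMap.comp_apply, LinearMap.comp_apply, LinearMap.comp_apply,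
            LinearMap.comp_apply, LinearMap.comp_apply, LinearMap.comp_apply, Submodule.subtype_apply,
            Submodule.subtype_apply, ← hfY _ (hE𝔥 j g hg), hE_u]
        have h := SymplecticWitness.theta_comp_eq_of_equivariant (ωb (j, 0)) (hωbnd (j, 0)) (hωbalt (j, 0))
          (hTskew (j, 0)) (hP (j, 0)) (hQ (j, 0)) (hPmem (j, 0)) (hQmem (j, 0)) (𝔰b (j, 0)) (h𝔰b (j, 0)) hΘΘ₁
          (ρ ∘ₗ E j) (hρΘk j) _ hGj
        have hx : (x : ℂ ⊗[ℚ] V₂) = uu j (vv j x) := (huv j x x.2).symm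
        have h' := LinearMap.congr_fun h ⟨vv j x, hvT j _ x.2⟩
        simp only [LinearMap.comp_apply, Submodule.subtype_apply, hTΘ_coe] at h'
        rw [hx, h', ← Module.End.mul_apply (f := uu j) (g := Θ₂), ← h𝔥u Θ₂ hΘ₂C j, Module.End.mul_apply]
      have hΘf : ∀ p (x : Tb p), Θ₁ (f x) = f (Θ₂ x) := by
        rintro ⟨j, a⟩ x
        rcases fin2_eq_zero_or_one_ib a with rfl | rfl
        · exact hΘf0 j x
        · exact hΘf1 j x
      refine hHom _ (LinearMap.ext fun x => ?_)
      rw [LinearMap.comp_apply, LinearMap.comp_apply, ← hf]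
      conv_lhs => rw [← hpr3 x, map_sum, map_sum]
      conv_rhs => rw [← hpr3 x, map_sum, map_sum]
      exact Finset.sum_congr rfl fun j _ => hΘf j (pr j x)
    obtain ⟨Φ, hΦ⟩ : ∃ L : Module.End ℂ (ℂ ⊗[ℚ] U) →ₗ[ℂ] (ℂ ⊗[ℚ] V₂ →ₗ[ℂ] ℂ ⊗[ℚ] V₁),
        ∀ T, L T = π₁.baseChange ℂ ∘ₗ T ∘ₗ ι₂.baseChange ℂ :=
      ⟨{ toFun := fun T => π₁.baseChange ℂ ∘ₗ T ∘ₗ ι₂.baseChange ℂ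
         map_add' := fun T T' => by rw [LinearMap.add_comp, LinearMap.comp_add]
         map_smul' := fun c T => by rw [LinearMap.smul_comp, LinearMap.comp_smul, RingHom.id_apply] },
        fun T => rfl⟩
    have hΦspan : ∀ T ∈ Submodule.span ℂ ((fun Z : Module.End ℚ U => Z.baseChange ℂ) ''
        {Z | ∀ X ∈ (𝔞₃' : Set (Module.End ℚ U)), Z * X = X * Z}), Φ T = 0 := by
      intro T hT
      induction hT using Submodule.span_induction with
      | mem T' hT' =>
        obtain ⟨Z, hZ, rfl⟩ := hT'
        rw [hΦ, ← LinearMap.baseChange_comp, ← LinearMap.baseChange_comp, hblock Z hZ, LinearMap.baseChange_zero]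
      | zero => rw [map_zero]
      | add T' T'' _ _ h' h'' => rw [map_add, h', h'', add_zero]
      | smul c T' _ h' => rw [map_smul, h', smul_zero]
    have hFm0 : Fm = 0 := by
      have h := hΦspan Z' hZ'span
      rw [hΦ, hZ'] at h
      have h' : π₁.baseChange ℂ ∘ₗ (ι₁.baseChange ℂ ∘ₗ Fm ∘ₗ π₂.baseChange ℂ) ∘ₗ ι₂.baseChange ℂ = Fm := by
        apply LinearMap.ext
        intro x
        simp only [LinearMap.comp_apply, proj_incl_baseChange hπι₁, proj_incl_baseChange hπι₂]
      rw [h'] at h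
      exact h
    apply hFne
    apply LinearMap.ext
    intro v
    have h := LinearMap.congr_fun hFm0 (v : ℂ ⊗[ℚ] V₂)
    rw [hFm, LinearMap.comp_apply, hpr1, LinearMap.zero_apply] at h
    rw [h, LinearMap.zero_apply]
  -- `ρ` kills `𝔥_ℂ`
  have hρ0 : ∀ Y ∈ H₂.hodgeLieC, ρ Y = 0 := by
    intro Y hY
    rw [hrestr' Y hY, map_sum]
    exact Finset.sum_eq_zero fun i _ => hclaim i _ (hrestr_skew Y hY (i, 0))
  -- conclusion: `Z₂ = c₂ X` with `X ∈ 𝔞₃'`, `c₁ X = 0`, so `ι₂ Z₂ π₂ = X ∈ 𝔞`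
  intro Z₂ hZ₂
  obtain ⟨X, hX, hXZ⟩ := Submodule.mem_map.1 ((h𝔞₃'map.symm ▸ hZ₂ : Z₂ ∈ 𝔞₃'.map cL₂))
  have hX𝔞 : X ∈ 𝔞 := h𝔞₃'le𝔞 hX
  have hc₁X : cL₁ X = 0 := by
    have h1 : (cL₁ X).baseChange ℂ = 0 := by
      rw [← hLC₁c, ← hρT _ (baseChange_mem_spanC hX), hLC₂c, hXZ]
      exact hρ0 _ (h𝔥C ▸ baseChange_mem_spanC hZ₂)
    have h2 : (cL₁ X).baseChange ℂ ∈ spanC (⊥ : Submodule ℚ (Module.End ℚ V₁)) := by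
      rw [h1]; exact Submodule.zero_mem _
    exact (Submodule.mem_bot ℚ).1 (mem_of_baseChange_mem_spanC ⊥ h2)
  have hdec := eq_incl_corner_add hπι₁ hπι₂ hsum (hP₁ X hX𝔞) (hP₂ X hX𝔞)
  rw [hcL₁] at hc₁X
  rw [hcL₂] at hXZ
  rw [hc₁X, hXZ] at hdec
  simp only [LinearMap.zero_comp, LinearMap.comp_zero, zero_add] at hdec
  rw [← hdec]
  exact hX𝔞

end Goursat

/-! ### §3 The annihilator algebra of a `Θ_U`-killed rational tensor on `V₁ ⊕ V₂`: `0 ⊕ hg(V₂) ⊆ 𝔞(q)` and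
`Θ₁ ⊕ 0 ∈ 𝔞(q)_ℂ` (isotypic rigid blocks) -/

section Main

universe u

variable {U V₁ V₂ : Type u} [AddCommGroup U] [Module ℚ U] [AddCommGroup V₁] [Module ℚ V₁]
  [AddCommGroup V₂] [Module ℚ V₂] [Module.Finite ℚ U] [Module.Finite ℚ V₁] [Module.Finite ℚ V₂]
  [HodgeTensorFacts.{u, u}] {n : ℤ} {ιp : Type} [Fintype ιp] [DecidableEq ιp]
variable {M d m : ℕ}

omit [Module.Finite ℚ U] [Module.Finite ℚ V₁] [Module.Finite ℚ V₂] [HodgeTensorFacts.{u, u}] in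
/-- Complexification of a sum of bilinear forms, evaluated (a copy of the private lemma of
`HodgeThetaAnnihilatorTimesRigidSymplectic`). [folklore] -/
private theorem baseChange_add_apply_ib (B B' : LinearMap.BilinForm ℚ U) (x y : ℂ ⊗[ℚ] U) :
    LinearMap.BilinForm.baseChange ℂ (B + B') x y =
      LinearMap.BilinForm.baseChange ℂ B x y + LinearMap.BilinForm.baseChange ℂ B' x y := by
  induction x using TensorProduct.induction_on with
  | zero => simp
  | tmul c v =>
    induction y using TensorProduct.induction_on with
    | zero => simp
    | tmul d w =>
      simp only [LinearMap.BilinForm.baseChange_tmul, LinearMap.add_apply, add_smul]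
    | add y y' hy hy' => rw [map_add, map_add, map_add, hy, hy']; abel
  | add x x' hx hx' =>
    rw [map_add, LinearMap.add_apply, map_add, map_add, LinearMap.add_apply, LinearMap.add_apply, hx, hx']
    abel

/-- **The core (Moonen–Zarhin Lemma (3.4) for a second factor with isotypic rigid symplectic blocks, Lie form, word
model).** For the annihilator algebra `𝔞 = annLie φ eQ aF q` of a rational tensor `q` on `U = ι₁V₁ ⊕ ι₂V₂` killed by
`Θ_U` (`φ = ψ₁(π₁·,π₁·) + ψ₂(π₂·,π₂·)`; `aF` = the Hodge endomorphisms `ι₁ a π₁`, `a ∈ End_Hdg(V₁)`, and the two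
projectors), where `V₂ ⊗ ℂ = ⊕_{(i,a)} T_(i,a)` is an internal orthogonal sum of blocks stable under `Lie Hg(H₂) ⊗ ℂ`,
glued in pairs by `u_i : T_(i,0) ⥲ T_(i,1)`, `v_i = u_i⁻¹` commuting with `Lie Hg(H₂) ⊗ ℂ`, with (ISOTYPIC RIGIDITY)
`N + u_i N v_i ∈ Lie Hg(H₂) ⊗ ℂ` for every skew `N` supported on `T_(i,0)` (the type II shape), and where
`Hom_Hdg(V₂, V₁) = 0`: `ι₂ Z π₂ ∈ 𝔞` for all `Z ∈ Lie Hg(H₂)` and `Θ_U ∈ 𝔞_ℂ` («either `Hg(X) = Hg(X₁) × Hg(X₂)` or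
`Hom(X₂, X₁) ≠ 0`»; Hazama: «Suppose `X₁` and `X₂` contain no factors of Type 4. Then … either `Hom(X₁, X₂) ≠ 0` or
`Hg(X₁ × X₂) = Hg(X₁) × Hg(X₂)`», here for `X₂` with `hg(X₂) ⊗ ℂ = ⊕ᵢ 𝔰𝔭(T_(i,0))` acting diagonally on
`T_(i,0) ⊗ ℂ²`). [cite: MoonenZarhin1999LowDim, §3 (3.1), Thm. (3.2)(1) and Lemma (3.4)]
[cite: Hazama1989, Thm. (= Gordon 7.6.2)] [cite: Milne1999LefschetzClasses, Prop. 4.8 (p. 660)]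
[cite: Deligne1982HodgeCycles, I §3 (proof of Prop. 3.4)] -/
theorem incl₂_mem_annLie_of_times_isotypicBlocks (hn : n = 1) (HU : HodgeStructure U n)
    (H₁ : HodgeStructure V₁ n) (H₂ : HodgeStructure V₂ n) (heff₁ : H₁.IsEffective) (heff₂ : H₂.IsEffective)
    {ι₁ : V₁ →ₗ[ℚ] U} {π₁ : U →ₗ[ℚ] V₁} {ι₂ : V₂ →ₗ[ℚ] U} {π₂ : U →ₗ[ℚ] V₂}
    (hπι₁ : π₁ ∘ₗ ι₁ = LinearMap.id) (hπι₂ : π₂ ∘ₗ ι₂ = LinearMap.id) (hπ₁ι₂ : π₁ ∘ₗ ι₂ = 0)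
    (hπ₂ι₁ : π₂ ∘ₗ ι₁ = 0) (hsum : ι₁ ∘ₗ π₁ + ι₂ ∘ₗ π₂ = LinearMap.id)
    (hι₁F : ∀ p, ∀ x ∈ H₁.piece p (n - p), ι₁.baseChange ℂ x ∈ HU.piece p (n - p))
    (hι₂F : ∀ p, ∀ x ∈ H₂.piece p (n - p), ι₂.baseChange ℂ x ∈ HU.piece p (n - p))
    (ψ₁ : H₁.Polarization) (ψ₂ : H₂.Polarization)
    (Tb : ιp × Fin 2 → Submodule ℂ (ℂ ⊗[ℚ] V₂)) (hint : DirectSum.IsInternal Tb)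
    (hYT : ∀ Y ∈ H₂.hodgeLieC, ∀ p, ∀ x ∈ Tb p, Y x ∈ Tb p)
    (hTorth : ∀ p p', p ≠ p' → ∀ x ∈ Tb p, ∀ y ∈ Tb p', ψ₂.form.baseChange ℂ x y = 0)
    (uu vv : ιp → Module.End ℂ (ℂ ⊗[ℚ] V₂))
    (huT : ∀ i, ∀ x ∈ Tb (i, 0), uu i x ∈ Tb (i, 1)) (hvT : ∀ i, ∀ x ∈ Tb (i, 1), vv i x ∈ Tb (i, 0))
    (hvu : ∀ i, ∀ x ∈ Tb (i, 0), vv i (uu i x) = x) (huv : ∀ i, ∀ x ∈ Tb (i, 1), uu i (vv i x) = x)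
    (hu0 : ∀ i p, p ≠ (i, 0) → ∀ x ∈ Tb p, uu i x = 0) (hv0 : ∀ i p, p ≠ (i, 1) → ∀ x ∈ Tb p, vv i x = 0)
    (h𝔥u : ∀ Y ∈ H₂.hodgeLieC, ∀ i, Y * uu i = uu i * Y) (h𝔥v : ∀ Y ∈ H₂.hodgeLieC, ∀ i, Y * vv i = vv i * Y)
    (hrigid : ∀ (i : ιp) (N : Module.End ℂ (ℂ ⊗[ℚ] V₂)), (∀ y, N y ∈ Tb (i, 0)) →
      (∀ p, p ≠ (i, 0) → ∀ y ∈ Tb p, N y = 0) →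
      (∀ x y, ψ₂.form.baseChange ℂ (N x) y + ψ₂.form.baseChange ℂ x (N y) = 0) → N + uu i * N * vv i ∈ H₂.hodgeLieC)
    (hHom : ∀ f : V₂ →ₗ[ℚ] V₁,
      (∀ p, ∀ x ∈ H₂.piece p (n - p), f.baseChange ℂ x ∈ H₁.piece p (n - p)) → f = 0)
    (eQ : Module.Basis (Fin M) ℚ U) (q : (Fin d → Fin m × Fin M) → ℚ)
    {ΘU : Module.End ℂ (ℂ ⊗[ℚ] U)} (hΘU : ∀ p, ∀ x ∈ HU.piece p (n - p), ΘU x = ((2 * p - n : ℤ) : ℂ) • x)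
    (hΘq : ∀ u : Fin d → Fin m, wordDerAt ℂ (fun _ : Fin d =>
      LinearMap.toMatrix (Algebra.TensorProduct.basis ℂ eQ) (Algebra.TensorProduct.basis ℂ eQ) ΘU)
      (wordSlice (fun w => algebraMap ℚ ℂ (q w)) u) = 0) :
    (∀ Z₂ ∈ H₂.hodgeLie,
      ι₂ ∘ₗ Z₂ ∘ₗ π₂ ∈ annLie (ψ₁.form.compl₁₂ π₁ π₁ + ψ₂.form.compl₁₂ π₂ π₂) eQ
        (Sum.elim (fun a : H₁.endAlg => ι₁ ∘ₗ (a : Module.End ℚ V₁) ∘ₗ π₁)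
          (Sum.elim (fun _ : Unit => ι₁ ∘ₗ π₁) (fun _ : Unit => ι₂ ∘ₗ π₂))) q) ∧
    ΘU ∈ spanC (annLie (ψ₁.form.compl₁₂ π₁ π₁ + ψ₂.form.compl₁₂ π₂ π₂) eQ
        (Sum.elim (fun a : H₁.endAlg => ι₁ ∘ₗ (a : Module.End ℚ V₁) ∘ₗ π₁)
          (Sum.elim (fun _ : Unit => ι₁ ∘ₗ π₁) (fun _ : Unit => ι₂ ∘ₗ π₂))) q) := by
  classical
  obtain ⟨Θ₁, hΘ₁⟩ := exists_hodgeTheta H₁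
  obtain ⟨Θ₂, hΘ₂⟩ := exists_hodgeTheta H₂
  have hΘ₁C : Θ₁ ∈ H₁.hodgeLieC := H₁.mem_hodgeLieC_of_forall_piece hΘ₁
  have hΘ₂C : Θ₂ ∈ H₂.hodgeLieC := H₂.mem_hodgeLieC_of_forall_piece hΘ₂
  have hsum' : ι₂ ∘ₗ π₂ + ι₁ ∘ₗ π₁ = LinearMap.id := by rw [add_comm]; exact hsum
  have e11 : ∀ v, π₁ (ι₁ v) = v := fun v => by
    rw [← LinearMap.comp_apply (f := π₁), hπι₁, LinearMap.id_apply]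
  have e21 : ∀ v, π₂ (ι₁ v) = 0 := fun v => by
    rw [← LinearMap.comp_apply (f := π₂), hπ₂ι₁, LinearMap.zero_apply]
  -- `Θ` through the presentation
  have hΘι₁ := theta_incl_eq HU H₁ hι₁F hΘU hΘ₁
  have hΘι₂ := theta_incl_eq HU H₂ hι₂F hΘU hΘ₂
  have hΘπ₁ := proj_theta_eq HU H₁ H₂ hπι₁ hπ₁ι₂ hsum hι₁F hι₂F hΘU hΘ₁ hΘ₂
  have hΘπ₂ := proj_theta_eq HU H₂ H₁ hπι₂ hπ₂ι₁ hsum' hι₂F hι₁F hΘU hΘ₂ hΘ₁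
  -- the commuting family and the orthogonal-sum form
  set aF : H₁.endAlg ⊕ (Unit ⊕ Unit) → Module.End ℚ U :=
    Sum.elim (fun a : H₁.endAlg => ι₁ ∘ₗ (a : Module.End ℚ V₁) ∘ₗ π₁)
      (Sum.elim (fun _ : Unit => ι₁ ∘ₗ π₁) (fun _ : Unit => ι₂ ∘ₗ π₂)) with haF
  set φ : LinearMap.BilinForm ℚ U := ψ₁.form.compl₁₂ π₁ π₁ + ψ₂.form.compl₁₂ π₂ π₂ with hφ
  have hφC : ∀ x y, φ.baseChange ℂ x y = ψ₁.form.baseChange ℂ (π₁.baseChange ℂ x) (π₁.baseChange ℂ y) +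
      ψ₂.form.baseChange ℂ (π₂.baseChange ℂ x) (π₂.baseChange ℂ y) := fun x y => by
    rw [hφ, baseChange_add_apply_ib, baseChange_compl₁₂_apply, baseChange_compl₁₂_apply]
  have hφapply : ∀ x y, φ x y = ψ₁.form (π₁ x) (π₁ y) + ψ₂.form (π₂ x) (π₂ y) := fun x y => by
    rw [hφ, LinearMap.add_apply, LinearMap.add_apply, LinearMap.compl₁₂_apply, LinearMap.compl₁₂_apply]
  set 𝔞 : Submodule ℚ (Module.End ℚ U) := annLie φ eQ aF q with h𝔞
  -- `Θ_U ∈ 𝔞_ℂ`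
  have hΘ𝔞 : ΘU ∈ spanC 𝔞 := by
    refine mem_spanC_annLie φ eQ aF q hΘq (fun i => ?_) (fun x y => ?_)
    · apply LinearMap.ext
      intro y
      rcases i with a | (_ | _)
      · change ΘU ((ι₁ ∘ₗ (a : Module.End ℚ V₁) ∘ₗ π₁).baseChange ℂ y) =
          (ι₁ ∘ₗ (a : Module.End ℚ V₁) ∘ₗ π₁).baseChange ℂ (ΘU y)
        simp only [LinearMap.baseChange_comp, LinearMap.comp_apply]
        rw [hΘι₁, ← Module.End.mul_apply (f := Θ₁), commute_baseChange_of_mem_hodgeLieC H₁ hΘ₁C a,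
          Module.End.mul_apply, hΘπ₁]
      · change ΘU ((ι₁ ∘ₗ π₁).baseChange ℂ y) = (ι₁ ∘ₗ π₁).baseChange ℂ (ΘU y)
        simp only [LinearMap.baseChange_comp, LinearMap.comp_apply]
        rw [hΘι₁, hΘπ₁]
      · change ΘU ((ι₂ ∘ₗ π₂).baseChange ℂ y) = (ι₂ ∘ₗ π₂).baseChange ℂ (ΘU y)
        simp only [LinearMap.baseChange_comp, LinearMap.comp_apply]
        rw [hΘι₂, hΘπ₂]
    · rw [hφC, hφC, hΘπ₁, hΘπ₁, hΘπ₂, hΘπ₂, formBaseChange_skew_of_mem_hodgeLieC ψ₁ hΘ₁C,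
        formBaseChange_skew_of_mem_hodgeLieC ψ₂ hΘ₂C]
      ring
  -- what membership in `𝔞` gives
  have hbr𝔞 : ∀ X ∈ 𝔞, ∀ X' ∈ 𝔞, X * X' - X' * X ∈ 𝔞 := fun X hX X' hX' =>
    commutator_mem_annLie φ eQ aF q hX hX'
  have hmem : ∀ X ∈ 𝔞, (∀ i, X * aF i = aF i * X) ∧ ∀ v w, φ (X v) w + φ v (X w) = 0 :=
    fun X hX => ((mem_annLie_iff φ eQ aF q X).1 hX).2
  have hP₁ : ∀ X ∈ 𝔞, X * (ι₁ ∘ₗ π₁) = (ι₁ ∘ₗ π₁) * X := fun X hX => (hmem X hX).1 (Sum.inr (Sum.inl ()))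
  have hP₂ : ∀ X ∈ 𝔞, X * (ι₂ ∘ₗ π₂) = (ι₂ ∘ₗ π₂) * X := fun X hX => (hmem X hX).1 (Sum.inr (Sum.inr ()))
  have hc₁skew : ∀ X ∈ 𝔞, ∀ v w, ψ₁.form ((π₁ ∘ₗ X ∘ₗ ι₁) v) w + ψ₁.form v ((π₁ ∘ₗ X ∘ₗ ι₁) w) = 0 := by
    intro X hX v w
    have h := (hmem X hX).2 (ι₁ v) (ι₁ w)
    rw [apply_incl_eq_of_commute_projector hπι₁ (hP₁ X hX) v,
      apply_incl_eq_of_commute_projector hπι₁ (hP₁ X hX) w, hφapply, hφapply] at h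
    simp only [e11, e21, map_zero, add_zero] at h
    simpa only [LinearMap.comp_apply] using h
  -- (HOM) in the `Θ`-form and the Goursat step
  have hHom' : ∀ f : V₂ →ₗ[ℚ] V₁, Θ₁ ∘ₗ f.baseChange ℂ = f.baseChange ℂ ∘ₗ Θ₂ → f = 0 := fun f hf =>
    eq_zero_of_theta_comp_eq_of_hom_eq_zero hn H₁ H₂ heff₁ heff₂ hΘ₁ hΘ₂ hHom hf
  have h2 := goursat_incl₂_mem_of_hom_eq_zero_of_isotypicBlocks hn H₁ H₂ heff₁ heff₂ hπι₁ hπι₂ hπ₁ι₂ hπ₂ι₁ hsum 𝔞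
    hbr𝔞 hP₁ hP₂ ψ₁ ψ₂ hc₁skew hΘ₁ hΘ₂ Tb hint hYT hTorth uu vv huT hvT hvu
      huv hu0 hv0 h𝔥u h𝔥v hrigid hΘ𝔞 hΘι₁ hΘι₂ hHom'
  exact ⟨h2, hΘ𝔞⟩

/-- **`0 ⊕ (hg(V₂) ⊗ ℂ) ⊆ 𝔞(q)_ℂ`**: with the hypotheses of the core theorem (isotypic rigid blocks),
`ι₂ ∘ Y ∘ π₂ ∈ 𝔞(q)_ℂ` for EVERY `Y ∈ Lie Hg(H₂) ⊗ ℂ` («`Hg(X₁ × X₂) ⊇ 1 × Hg(X₂)`» read on tensors).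
[cite: MoonenZarhin1999LowDim, §3 (3.1), Thm. (3.2)(1) and Lemma (3.4)] [cite: Hazama1989, Thm. (= Gordon 7.6.2)]
[cite: Deligne1982HodgeCycles, I §3 (proof of Prop. 3.4)] -/
theorem incl₂_comp_proj_mem_spanC_annLie_of_times_isotypicBlocks (hn : n = 1) (HU : HodgeStructure U n)
    (H₁ : HodgeStructure V₁ n) (H₂ : HodgeStructure V₂ n) (heff₁ : H₁.IsEffective) (heff₂ : H₂.IsEffective)
    {ι₁ : V₁ →ₗ[ℚ] U} {π₁ : U →ₗ[ℚ] V₁} {ι₂ : V₂ →ₗ[ℚ] U} {π₂ : U →ₗ[ℚ] V₂}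
    (hπι₁ : π₁ ∘ₗ ι₁ = LinearMap.id) (hπι₂ : π₂ ∘ₗ ι₂ = LinearMap.id) (hπ₁ι₂ : π₁ ∘ₗ ι₂ = 0)
    (hπ₂ι₁ : π₂ ∘ₗ ι₁ = 0) (hsum : ι₁ ∘ₗ π₁ + ι₂ ∘ₗ π₂ = LinearMap.id)
    (hι₁F : ∀ p, ∀ x ∈ H₁.piece p (n - p), ι₁.baseChange ℂ x ∈ HU.piece p (n - p))
    (hι₂F : ∀ p, ∀ x ∈ H₂.piece p (n - p), ι₂.baseChange ℂ x ∈ HU.piece p (n - p))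
    (ψ₁ : H₁.Polarization) (ψ₂ : H₂.Polarization)
    (Tb : ιp × Fin 2 → Submodule ℂ (ℂ ⊗[ℚ] V₂)) (hint : DirectSum.IsInternal Tb)
    (hYT : ∀ Y ∈ H₂.hodgeLieC, ∀ p, ∀ x ∈ Tb p, Y x ∈ Tb p)
    (hTorth : ∀ p p', p ≠ p' → ∀ x ∈ Tb p, ∀ y ∈ Tb p', ψ₂.form.baseChange ℂ x y = 0)
    (uu vv : ιp → Module.End ℂ (ℂ ⊗[ℚ] V₂))
    (huT : ∀ i, ∀ x ∈ Tb (i, 0), uu i x ∈ Tb (i, 1)) (hvT : ∀ i, ∀ x ∈ Tb (i, 1), vv i x ∈ Tb (i, 0))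
    (hvu : ∀ i, ∀ x ∈ Tb (i, 0), vv i (uu i x) = x) (huv : ∀ i, ∀ x ∈ Tb (i, 1), uu i (vv i x) = x)
    (hu0 : ∀ i p, p ≠ (i, 0) → ∀ x ∈ Tb p, uu i x = 0) (hv0 : ∀ i p, p ≠ (i, 1) → ∀ x ∈ Tb p, vv i x = 0)
    (h𝔥u : ∀ Y ∈ H₂.hodgeLieC, ∀ i, Y * uu i = uu i * Y) (h𝔥v : ∀ Y ∈ H₂.hodgeLieC, ∀ i, Y * vv i = vv i * Y)
    (hrigid : ∀ (i : ιp) (N : Module.End ℂ (ℂ ⊗[ℚ] V₂)), (∀ y, N y ∈ Tb (i, 0)) →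
      (∀ p, p ≠ (i, 0) → ∀ y ∈ Tb p, N y = 0) →
      (∀ x y, ψ₂.form.baseChange ℂ (N x) y + ψ₂.form.baseChange ℂ x (N y) = 0) → N + uu i * N * vv i ∈ H₂.hodgeLieC)
    (hHom : ∀ f : V₂ →ₗ[ℚ] V₁,
      (∀ p, ∀ x ∈ H₂.piece p (n - p), f.baseChange ℂ x ∈ H₁.piece p (n - p)) → f = 0)
    (eQ : Module.Basis (Fin M) ℚ U) (q : (Fin d → Fin m × Fin M) → ℚ)
    {ΘU : Module.End ℂ (ℂ ⊗[ℚ] U)} (hΘU : ∀ p, ∀ x ∈ HU.piece p (n - p), ΘU x = ((2 * p - n : ℤ) : ℂ) • x)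
    (hΘq : ∀ u : Fin d → Fin m, wordDerAt ℂ (fun _ : Fin d =>
      LinearMap.toMatrix (Algebra.TensorProduct.basis ℂ eQ) (Algebra.TensorProduct.basis ℂ eQ) ΘU)
      (wordSlice (fun w => algebraMap ℚ ℂ (q w)) u) = 0)
    {Y : Module.End ℂ (ℂ ⊗[ℚ] V₂)} (hY : Y ∈ H₂.hodgeLieC) :
    ι₂.baseChange ℂ ∘ₗ Y ∘ₗ π₂.baseChange ℂ ∈ spanC (annLie (ψ₁.form.compl₁₂ π₁ π₁ + ψ₂.form.compl₁₂ π₂ π₂) eQ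
        (Sum.elim (fun a : H₁.endAlg => ι₁ ∘ₗ (a : Module.End ℚ V₁) ∘ₗ π₁)
          (Sum.elim (fun _ : Unit => ι₁ ∘ₗ π₁) (fun _ : Unit => ι₂ ∘ₗ π₂))) q) := by
  classical
  obtain ⟨h2, -⟩ := incl₂_mem_annLie_of_times_isotypicBlocks hn HU H₁ H₂ heff₁ heff₂ hπι₁ hπι₂ hπ₁ι₂ hπ₂ι₁ hsum hι₁F
    hι₂F ψ₁ ψ₂ Tb hint hYT hTorth uu vv huT hvT hvu
      huv hu0 hv0 h𝔥u h𝔥v hrigid hHom eQ q hΘU hΘq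
  rw [hodgeLieC_eq_spanC] at hY
  induction hY using Submodule.span_induction with
  | mem Y₁ hY₁ =>
    obtain ⟨X, hX, rfl⟩ := hY₁
    rw [← LinearMap.baseChange_comp, ← LinearMap.baseChange_comp]
    exact baseChange_mem_spanC (h2 X hX)
  | zero => rw [LinearMap.zero_comp, LinearMap.comp_zero]; exact Submodule.zero_mem _
  | add Y₁ Y₂ _ _ hY₁ hY₂ => rw [LinearMap.add_comp, LinearMap.comp_add]; exact Submodule.add_mem _ hY₁ hY₂
  | smul c Y₁ _ hY₁ => rw [LinearMap.smul_comp, LinearMap.comp_smul]; exact Submodule.smul_mem _ c hY₁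

/-- **Theorem (second factor, word model): the rational `Θ_U`-killed tensor `q` on `U = H¹(X₁) ⊕ H¹(X₂)` is killed
by the matrix of `ι₂ ∘ Y ∘ π₂` for EVERY `Y ∈ Lie Hg(X₂) ⊗ ℂ`** (`X₂` with isotypic rigid symplectic blocks — the type
II shape —, `Hom(X₂, X₁) = 0`): «`Hg(X₁ × X₂) ⊇ 1 × Hg(X₂)`» read on tensors.
[cite: MoonenZarhin1999LowDim, §3 (3.1), Thm. (3.2)(1) and Lemma (3.4)] [cite: Hazama1989, Thm. (= Gordon 7.6.2)]
[cite: Deligne1982HodgeCycles, I §3 (proof of Prop. 3.4)] -/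
theorem wordDerAt_incl₂_eq_zero_of_times_isotypicBlocks (hn : n = 1) (HU : HodgeStructure U n)
    (H₁ : HodgeStructure V₁ n) (H₂ : HodgeStructure V₂ n) (heff₁ : H₁.IsEffective) (heff₂ : H₂.IsEffective)
    {ι₁ : V₁ →ₗ[ℚ] U} {π₁ : U →ₗ[ℚ] V₁} {ι₂ : V₂ →ₗ[ℚ] U} {π₂ : U →ₗ[ℚ] V₂}
    (hπι₁ : π₁ ∘ₗ ι₁ = LinearMap.id) (hπι₂ : π₂ ∘ₗ ι₂ = LinearMap.id) (hπ₁ι₂ : π₁ ∘ₗ ι₂ = 0)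
    (hπ₂ι₁ : π₂ ∘ₗ ι₁ = 0) (hsum : ι₁ ∘ₗ π₁ + ι₂ ∘ₗ π₂ = LinearMap.id)
    (hι₁F : ∀ p, ∀ x ∈ H₁.piece p (n - p), ι₁.baseChange ℂ x ∈ HU.piece p (n - p))
    (hι₂F : ∀ p, ∀ x ∈ H₂.piece p (n - p), ι₂.baseChange ℂ x ∈ HU.piece p (n - p))
    (ψ₁ : H₁.Polarization) (ψ₂ : H₂.Polarization)
    (Tb : ιp × Fin 2 → Submodule ℂ (ℂ ⊗[ℚ] V₂)) (hint : DirectSum.IsInternal Tb)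
    (hYT : ∀ Y ∈ H₂.hodgeLieC, ∀ p, ∀ x ∈ Tb p, Y x ∈ Tb p)
    (hTorth : ∀ p p', p ≠ p' → ∀ x ∈ Tb p, ∀ y ∈ Tb p', ψ₂.form.baseChange ℂ x y = 0)
    (uu vv : ιp → Module.End ℂ (ℂ ⊗[ℚ] V₂))
    (huT : ∀ i, ∀ x ∈ Tb (i, 0), uu i x ∈ Tb (i, 1)) (hvT : ∀ i, ∀ x ∈ Tb (i, 1), vv i x ∈ Tb (i, 0))
    (hvu : ∀ i, ∀ x ∈ Tb (i, 0), vv i (uu i x) = x) (huv : ∀ i, ∀ x ∈ Tb (i, 1), uu i (vv i x) = x)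
    (hu0 : ∀ i p, p ≠ (i, 0) → ∀ x ∈ Tb p, uu i x = 0) (hv0 : ∀ i p, p ≠ (i, 1) → ∀ x ∈ Tb p, vv i x = 0)
    (h𝔥u : ∀ Y ∈ H₂.hodgeLieC, ∀ i, Y * uu i = uu i * Y) (h𝔥v : ∀ Y ∈ H₂.hodgeLieC, ∀ i, Y * vv i = vv i * Y)
    (hrigid : ∀ (i : ιp) (N : Module.End ℂ (ℂ ⊗[ℚ] V₂)), (∀ y, N y ∈ Tb (i, 0)) →
      (∀ p, p ≠ (i, 0) → ∀ y ∈ Tb p, N y = 0) →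
      (∀ x y, ψ₂.form.baseChange ℂ (N x) y + ψ₂.form.baseChange ℂ x (N y) = 0) → N + uu i * N * vv i ∈ H₂.hodgeLieC)
    (hHom : ∀ f : V₂ →ₗ[ℚ] V₁,
      (∀ p, ∀ x ∈ H₂.piece p (n - p), f.baseChange ℂ x ∈ H₁.piece p (n - p)) → f = 0)
    (eQ : Module.Basis (Fin M) ℚ U) (q : (Fin d → Fin m × Fin M) → ℚ)
    {ΘU : Module.End ℂ (ℂ ⊗[ℚ] U)} (hΘU : ∀ p, ∀ x ∈ HU.piece p (n - p), ΘU x = ((2 * p - n : ℤ) : ℂ) • x)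
    (hΘq : ∀ u : Fin d → Fin m, wordDerAt ℂ (fun _ : Fin d =>
      LinearMap.toMatrix (Algebra.TensorProduct.basis ℂ eQ) (Algebra.TensorProduct.basis ℂ eQ) ΘU)
      (wordSlice (fun w => algebraMap ℚ ℂ (q w)) u) = 0)
    {Y : Module.End ℂ (ℂ ⊗[ℚ] V₂)} (hY : Y ∈ H₂.hodgeLieC) (u : Fin d → Fin m) :
    wordDerAt ℂ (fun _ : Fin d =>
      LinearMap.toMatrix (Algebra.TensorProduct.basis ℂ eQ) (Algebra.TensorProduct.basis ℂ eQ)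
        (ι₂.baseChange ℂ ∘ₗ Y ∘ₗ π₂.baseChange ℂ))
      (wordSlice (fun w => algebraMap ℚ ℂ (q w)) u) = 0 :=
  wordDerAt_eq_zero_of_mem_spanC_annLie _ eQ _ q
    (incl₂_comp_proj_mem_spanC_annLie_of_times_isotypicBlocks hn HU H₁ H₂ heff₁ heff₂ hπι₁ hπι₂ hπ₁ι₂ hπ₂ι₁ hsum hι₁F
      hι₂F ψ₁ ψ₂ Tb hint hYT hTorth uu vv huT hvT hvu
      huv hu0 hv0 h𝔥u h𝔥v hrigid hHom eQ q hΘU hΘq hY) u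

/-- **`Θ_{X₁} ⊕ 0 ∈ 𝔞(q)_ℂ`**: with the hypotheses of the core theorem (isotypic rigid blocks), the partial Hodge
operator `ι₁ ∘ Θ₁ ∘ π₁ = Θ_U - ι₂ ∘ Θ₂ ∘ π₂` of the first factor lies in `𝔞(q)_ℂ` («`Hg(X₁ × X₂) ⊇ Hg(X₁) × 1 ∋` the
circle `Θ_{X₁}`»). [cite: MoonenZarhin1999LowDim, §3 (3.1), Thm. (3.2)(1) and Lemma (3.4)]
[cite: Hazama1989, Thm. (= Gordon 7.6.2)] [cite: Deligne1982HodgeCycles, I §3 (proof of Prop. 3.4)] -/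
theorem incl₁_theta_proj_mem_spanC_annLie_of_times_isotypicBlocks (hn : n = 1) (HU : HodgeStructure U n)
    (H₁ : HodgeStructure V₁ n) (H₂ : HodgeStructure V₂ n) (heff₁ : H₁.IsEffective) (heff₂ : H₂.IsEffective)
    {ι₁ : V₁ →ₗ[ℚ] U} {π₁ : U →ₗ[ℚ] V₁} {ι₂ : V₂ →ₗ[ℚ] U} {π₂ : U →ₗ[ℚ] V₂}
    (hπι₁ : π₁ ∘ₗ ι₁ = LinearMap.id) (hπι₂ : π₂ ∘ₗ ι₂ = LinearMap.id) (hπ₁ι₂ : π₁ ∘ₗ ι₂ = 0)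
    (hπ₂ι₁ : π₂ ∘ₗ ι₁ = 0) (hsum : ι₁ ∘ₗ π₁ + ι₂ ∘ₗ π₂ = LinearMap.id)
    (hι₁F : ∀ p, ∀ x ∈ H₁.piece p (n - p), ι₁.baseChange ℂ x ∈ HU.piece p (n - p))
    (hι₂F : ∀ p, ∀ x ∈ H₂.piece p (n - p), ι₂.baseChange ℂ x ∈ HU.piece p (n - p))
    (ψ₁ : H₁.Polarization) (ψ₂ : H₂.Polarization)
    (Tb : ιp × Fin 2 → Submodule ℂ (ℂ ⊗[ℚ] V₂)) (hint : DirectSum.IsInternal Tb)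
    (hYT : ∀ Y ∈ H₂.hodgeLieC, ∀ p, ∀ x ∈ Tb p, Y x ∈ Tb p)
    (hTorth : ∀ p p', p ≠ p' → ∀ x ∈ Tb p, ∀ y ∈ Tb p', ψ₂.form.baseChange ℂ x y = 0)
    (uu vv : ιp → Module.End ℂ (ℂ ⊗[ℚ] V₂))
    (huT : ∀ i, ∀ x ∈ Tb (i, 0), uu i x ∈ Tb (i, 1)) (hvT : ∀ i, ∀ x ∈ Tb (i, 1), vv i x ∈ Tb (i, 0))
    (hvu : ∀ i, ∀ x ∈ Tb (i, 0), vv i (uu i x) = x) (huv : ∀ i, ∀ x ∈ Tb (i, 1), uu i (vv i x) = x)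
    (hu0 : ∀ i p, p ≠ (i, 0) → ∀ x ∈ Tb p, uu i x = 0) (hv0 : ∀ i p, p ≠ (i, 1) → ∀ x ∈ Tb p, vv i x = 0)
    (h𝔥u : ∀ Y ∈ H₂.hodgeLieC, ∀ i, Y * uu i = uu i * Y) (h𝔥v : ∀ Y ∈ H₂.hodgeLieC, ∀ i, Y * vv i = vv i * Y)
    (hrigid : ∀ (i : ιp) (N : Module.End ℂ (ℂ ⊗[ℚ] V₂)), (∀ y, N y ∈ Tb (i, 0)) →
      (∀ p, p ≠ (i, 0) → ∀ y ∈ Tb p, N y = 0) →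
      (∀ x y, ψ₂.form.baseChange ℂ (N x) y + ψ₂.form.baseChange ℂ x (N y) = 0) → N + uu i * N * vv i ∈ H₂.hodgeLieC)
    (hHom : ∀ f : V₂ →ₗ[ℚ] V₁,
      (∀ p, ∀ x ∈ H₂.piece p (n - p), f.baseChange ℂ x ∈ H₁.piece p (n - p)) → f = 0)
    (eQ : Module.Basis (Fin M) ℚ U) (q : (Fin d → Fin m × Fin M) → ℚ)
    {ΘU : Module.End ℂ (ℂ ⊗[ℚ] U)} (hΘU : ∀ p, ∀ x ∈ HU.piece p (n - p), ΘU x = ((2 * p - n : ℤ) : ℂ) • x)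
    (hΘq : ∀ u : Fin d → Fin m, wordDerAt ℂ (fun _ : Fin d =>
      LinearMap.toMatrix (Algebra.TensorProduct.basis ℂ eQ) (Algebra.TensorProduct.basis ℂ eQ) ΘU)
      (wordSlice (fun w => algebraMap ℚ ℂ (q w)) u) = 0)
    {Θ₁ : Module.End ℂ (ℂ ⊗[ℚ] V₁)} (hΘ₁ : ∀ p, ∀ x ∈ H₁.piece p (n - p), Θ₁ x = ((2 * p - n : ℤ) : ℂ) • x) :
    ι₁.baseChange ℂ ∘ₗ Θ₁ ∘ₗ π₁.baseChange ℂ ∈ spanC (annLie (ψ₁.form.compl₁₂ π₁ π₁ + ψ₂.form.compl₁₂ π₂ π₂) eQ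
        (Sum.elim (fun a : H₁.endAlg => ι₁ ∘ₗ (a : Module.End ℚ V₁) ∘ₗ π₁)
          (Sum.elim (fun _ : Unit => ι₁ ∘ₗ π₁) (fun _ : Unit => ι₂ ∘ₗ π₂))) q) := by
  obtain ⟨Θ₂, hΘ₂⟩ := exists_hodgeTheta H₂
  have hΘ₂C : Θ₂ ∈ H₂.hodgeLieC := H₂.mem_hodgeLieC_of_forall_piece hΘ₂
  have hΘ𝔞 := (incl₂_mem_annLie_of_times_isotypicBlocks hn HU H₁ H₂ heff₁ heff₂ hπι₁ hπι₂ hπ₁ι₂ hπ₂ι₁ hsum hι₁F hι₂F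
    ψ₁ ψ₂ Tb hint hYT hTorth uu vv huT hvT hvu
      huv hu0 hv0 h𝔥u h𝔥v hrigid hHom eQ q hΘU hΘq).2
  have h2 := incl₂_comp_proj_mem_spanC_annLie_of_times_isotypicBlocks hn HU H₁ H₂ heff₁ heff₂ hπι₁ hπι₂ hπ₁ι₂ hπ₂ι₁
    hsum hι₁F hι₂F ψ₁ ψ₂ Tb hint hYT hTorth uu vv huT hvT hvu
      huv hu0 hv0 h𝔥u h𝔥v hrigid hHom eQ q hΘU hΘq hΘ₂C
  have hΘι₁ := theta_incl_eq HU H₁ hι₁F hΘU hΘ₁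
  have hΘι₂ := theta_incl_eq HU H₂ hι₂F hΘU hΘ₂
  have hΘUy : ∀ y, ΘU y = ι₁.baseChange ℂ (Θ₁ (π₁.baseChange ℂ y)) + ι₂.baseChange ℂ (Θ₂ (π₂.baseChange ℂ y)) := by
    intro y
    conv_lhs => rw [← incl_proj_add_baseChange hsum y]
    rw [map_add, hΘι₁, hΘι₂]
  have hdec : ι₁.baseChange ℂ ∘ₗ Θ₁ ∘ₗ π₁.baseChange ℂ = ΘU - ι₂.baseChange ℂ ∘ₗ Θ₂ ∘ₗ π₂.baseChange ℂ := by
    apply LinearMap.ext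
    intro y
    simp only [LinearMap.sub_apply, LinearMap.comp_apply, hΘUy, add_sub_cancel_right]
  rw [hdec]
  exact Submodule.sub_mem _ hΘ𝔞 h2

/-- **Theorem (first factor, word model; Moonen–Zarhin Lemma (3.4) / Hazama's theorem with a second factor of the
type II shape: Hodge Lie algebra `⊕ᵢ 𝔰𝔭(T_(i,0))` acting diagonally on isotypic rigid blocks `T_(i,0) ⊕ u_i T_(i,0)`).**
Let `U = ι₁V₁ ⊕ ι₂V₂` be a presentation compatible with effective weight-one Hodge structures `H_U`, `H₁`, `H₂`,
polarizations `ψ₁`, `ψ₂`; on `V₂`, `V₂ ⊗ ℂ = ⊕_{(i,a)} T_(i,a)` is an internal orthogonal sum of blocks stable under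
`Lie Hg(H₂) ⊗ ℂ`, glued by `u_i`, `v_i` as in `goursat_incl₂_mem_of_hom_eq_zero_of_isotypicBlocks`, and every skew `N`
supported on `T_(i,0)` has `N + u_i N v_i ∈ Lie Hg(H₂) ⊗ ℂ`; and `Hom_Hdg(V₂, V₁) = 0`. If a RATIONAL coefficient
tensor `q` on `U` is killed, slice by slice, by the matrix of the Hodge operator `Θ_U`, then it is killed by the matrix
of the partial Hodge operator `ι₁ ∘ Θ₁ ∘ π₁` of the first factor — the conclusion of the tree's
`wordDerAt_incl_proj_theta_eq_zero_of_times_rigidBlocks`, so the typed-Künneth pipeline of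
`HodgeTheory/TimesGenericStablyNondegenerateProductSpan` applies verbatim to `X₁ × X₂`. The hypotheses on `X₁` are NONE.
[cite: MoonenZarhin1999LowDim, §3 (3.1), Thm. (3.2)(1), Lemma (3.3), Lemma (3.4)] [cite: Hazama1989, Thm. (= Gordon 7.6.2)]
[cite: Milne1999LefschetzClasses, Prop. 4.8 (p. 660)] [cite: Deligne1982HodgeCycles, I §3 Prop. 3.4 and Prop. 3.6] -/
theorem wordDerAt_incl_proj_theta_eq_zero_of_times_isotypicBlocks (hn : n = 1) (HU : HodgeStructure U n)
    (H₁ : HodgeStructure V₁ n) (H₂ : HodgeStructure V₂ n) (heff₁ : H₁.IsEffective) (heff₂ : H₂.IsEffective)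
    {ι₁ : V₁ →ₗ[ℚ] U} {π₁ : U →ₗ[ℚ] V₁} {ι₂ : V₂ →ₗ[ℚ] U} {π₂ : U →ₗ[ℚ] V₂}
    (hπι₁ : π₁ ∘ₗ ι₁ = LinearMap.id) (hπι₂ : π₂ ∘ₗ ι₂ = LinearMap.id) (hπ₁ι₂ : π₁ ∘ₗ ι₂ = 0)
    (hπ₂ι₁ : π₂ ∘ₗ ι₁ = 0) (hsum : ι₁ ∘ₗ π₁ + ι₂ ∘ₗ π₂ = LinearMap.id)
    (hι₁F : ∀ p, ∀ x ∈ H₁.piece p (n - p), ι₁.baseChange ℂ x ∈ HU.piece p (n - p))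
    (hι₂F : ∀ p, ∀ x ∈ H₂.piece p (n - p), ι₂.baseChange ℂ x ∈ HU.piece p (n - p))
    (ψ₁ : H₁.Polarization) (ψ₂ : H₂.Polarization)
    (Tb : ιp × Fin 2 → Submodule ℂ (ℂ ⊗[ℚ] V₂)) (hint : DirectSum.IsInternal Tb)
    (hYT : ∀ Y ∈ H₂.hodgeLieC, ∀ p, ∀ x ∈ Tb p, Y x ∈ Tb p)
    (hTorth : ∀ p p', p ≠ p' → ∀ x ∈ Tb p, ∀ y ∈ Tb p', ψ₂.form.baseChange ℂ x y = 0)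
    (uu vv : ιp → Module.End ℂ (ℂ ⊗[ℚ] V₂))
    (huT : ∀ i, ∀ x ∈ Tb (i, 0), uu i x ∈ Tb (i, 1)) (hvT : ∀ i, ∀ x ∈ Tb (i, 1), vv i x ∈ Tb (i, 0))
    (hvu : ∀ i, ∀ x ∈ Tb (i, 0), vv i (uu i x) = x) (huv : ∀ i, ∀ x ∈ Tb (i, 1), uu i (vv i x) = x)
    (hu0 : ∀ i p, p ≠ (i, 0) → ∀ x ∈ Tb p, uu i x = 0) (hv0 : ∀ i p, p ≠ (i, 1) → ∀ x ∈ Tb p, vv i x = 0)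
    (h𝔥u : ∀ Y ∈ H₂.hodgeLieC, ∀ i, Y * uu i = uu i * Y) (h𝔥v : ∀ Y ∈ H₂.hodgeLieC, ∀ i, Y * vv i = vv i * Y)
    (hrigid : ∀ (i : ιp) (N : Module.End ℂ (ℂ ⊗[ℚ] V₂)), (∀ y, N y ∈ Tb (i, 0)) →
      (∀ p, p ≠ (i, 0) → ∀ y ∈ Tb p, N y = 0) →
      (∀ x y, ψ₂.form.baseChange ℂ (N x) y + ψ₂.form.baseChange ℂ x (N y) = 0) → N + uu i * N * vv i ∈ H₂.hodgeLieC)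
    (hHom : ∀ f : V₂ →ₗ[ℚ] V₁,
      (∀ p, ∀ x ∈ H₂.piece p (n - p), f.baseChange ℂ x ∈ H₁.piece p (n - p)) → f = 0)
    (eQ : Module.Basis (Fin M) ℚ U) (q : (Fin d → Fin m × Fin M) → ℚ)
    {ΘU : Module.End ℂ (ℂ ⊗[ℚ] U)} (hΘU : ∀ p, ∀ x ∈ HU.piece p (n - p), ΘU x = ((2 * p - n : ℤ) : ℂ) • x)
    (hΘq : ∀ u : Fin d → Fin m, wordDerAt ℂ (fun _ : Fin d =>
      LinearMap.toMatrix (Algebra.TensorProduct.basis ℂ eQ) (Algebra.TensorProduct.basis ℂ eQ) ΘU)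
      (wordSlice (fun w => algebraMap ℚ ℂ (q w)) u) = 0)
    {Θ₁ : Module.End ℂ (ℂ ⊗[ℚ] V₁)} (hΘ₁ : ∀ p, ∀ x ∈ H₁.piece p (n - p), Θ₁ x = ((2 * p - n : ℤ) : ℂ) • x)
    (u : Fin d → Fin m) :
    wordDerAt ℂ (fun _ : Fin d =>
      LinearMap.toMatrix (Algebra.TensorProduct.basis ℂ eQ) (Algebra.TensorProduct.basis ℂ eQ)
        (ι₁.baseChange ℂ ∘ₗ Θ₁ ∘ₗ π₁.baseChange ℂ))
      (wordSlice (fun w => algebraMap ℚ ℂ (q w)) u) = 0 :=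
  wordDerAt_eq_zero_of_mem_spanC_annLie _ eQ _ q
    (incl₁_theta_proj_mem_spanC_annLie_of_times_isotypicBlocks hn HU H₁ H₂ heff₁ heff₂ hπι₁ hπι₂ hπ₁ι₂ hπ₂ι₁ hsum hι₁F
      hι₂F ψ₁ ψ₂ Tb hint hYT hTorth uu vv huT hvT hvu
      huv hu0 hv0 h𝔥u h𝔥v hrigid hHom eQ q hΘU hΘq hΘ₁) u

end Main

end HodgeStructure

end Literature.AlgebraicGeometry.Motives

end
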